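import Literature.NumberTheory.EllipticCurves.BSDSelmerSmithGoldfeldProofs
import Literature.NumberTheory.EllipticCurves.QuadraticTwistKroneckerRootNumberProofs
import Literature.NumberTheory.EllipticCurves.RootNumberTwistSemistableProofs
import Literature.NumberTheory.EllipticCurves.QuadraticTwistJInvariantProofs
import HarnessLib

/-!
# Equidistribution of the root number in the quadratic twist family, from the Modularity Theorem

A `…Proofs` companion (theorems only: no definition, no named fact, no instance) of
`Literature.NumberTheory.EllipticCurves.BSDSelmer` §bsd.S34 (A. Smith, *The Birch and
Swinnerton-Dyer conjecture implies Goldfeld's conjecture*, arXiv:2503.17619, Thm. 1.1) and of the tree's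
reductions `smith_selmerCorank_density_iff_le_one_and_rootNumber[_of_exists_isNewformOf]`
(`BSDSelmerSmithDensityProofs`): Thm. 1.1 for an elliptic `W / ℚ` is equivalent to the conjunction
of "`r_{2^∞}(E^d) ≤ 1` for `100 %` of the squarefree `d`" and "`w(E^d) = +1` for `50 %` of the
squarefree `d`", granted `2`-parity. This file PROVES the second conjunct from the Modularity
Theorem `exists_isNewformOf` alone:

* `twistDensity_rootNumber_quadraticTwist_eq_one` : for every elliptic `W / ℚ`,
  **`twistDensity (fun d ↦ d ≠ 0 ∧ w(W^d) = 1) (1/2)`** — among the squarefree `d` ordered by `|d|`,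
  the quadratic twists `W^d` with global root number `+1` have density `1/2` (the classical input to
  Goldfeld's conjecture; Murty–Murty 1997, Ch. 6 §1 for the sign of the twisted functional equation);
* `smith_selmerCorank_density_iff_le_one_of_exists_isNewformOf` : hence, granted the Modularity
  Theorem and Monsky's `2`-parity congruence (`monsky_selmerCorank_two_mod_two_eq`, bsd.S19 at
  `p = 2`), **Smith's Thm. 1.1 (`smith_selmerCorank_density W`) is equivalent to its core statement
  "`r_{2^∞}(E^d) ≤ 1` for `100 %` of the squarefree `d`"** — the root-number half of the reduction
  is discharged;
* the same density in Smith's printed normalisation (all `d ≠ 0` with `|d| ≤ H`, over `2H`):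
  `tendsto_card_rootNumber_quadraticTwist_eq`;
* `smith_selmerCorank_density_iff_two_le_of_exists_isNewformOf` : equivalently, Thm. 1.1 says exactly
  that the twists with `r_{2^∞}(E^d) ≥ 2` have density `0`;
* `smith_selmerCorank_density_smul_iff` : Thm. 1.1 is a statement about the elliptic curve, not the
  Weierstrass model (`(C • W)^d ≅ W^d`);
* `smith_rank_of_rootNumber_iff_printed` : granted Modularity, the tree's transcription
  `smith_rank_of_rootNumber W` of **Cor. 1.3** (density `1` of two implications) is equivalent to the
  printed pair of conditional densities ("among the twists with `w = +1`, `100 %` have rank `0`; among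
  those with `w = −1`, `100 %` have rank `≤ 1`", all `d ≠ 0`), each root-number class having density
  `1/2`; `smith_rank_of_rootNumber_printed_of_exists_isNewformOf` : Cor. 1.3 as printed from Thm. 1.1,
  Monsky's congruence and Modularity;
* `smith_selmerCorank_density_iff_eventually_ge` : granted Modularity and Monsky's congruence, the
  upper bounds of Thm. 1.1 (`≤ 1/2 + ε` for corank `0` and for corank `1`) hold by parity alone
  (`eventually_ratio_selmerCorankTwoInfty_eq_zero_le/one_le`), so Thm. 1.1 is equivalent to its two
  lower bounds.

## Proof

No local root numbers are used. Let `N = N_W` and `Q = 2N`. Every squarefree integer factors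
uniquely as `d = δ · χ₄(m) · m` with `δ` a squarefree divisor (of either sign) of `Q` and `m ≥ 1`
squarefree and prime to `Q` (`exists_eq_mul_χ₄_mul`, `eq_of_mul_χ₄_mul_eq`; `|δ| = gcd(d, Q)`), so
that `D = χ₄(m) m ≡ 1 (mod 4)` is an odd fundamental discriminant prime to `N_{W^δ}` (the conductor
of `W^δ` is supported on the primes of `Q`: `not_dvd_conductorNorm_quadraticTwist_of_not_dvd`, from
`f_v = 0 ↔` good reduction, `N = ∏ p^{f_p}` and the invariance of the reduction type under a twist by
a `v`-unit). The tree's twisted functional equation from Modularity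
(`WeierstrassCurve.rootNumber_quadraticTwist_of_emod_four_eq_one`, Murty–Murty 1997, Ch. 6 §1:
`w(E^{(D)}) = χ_D(−N_E) w(E)` for `(D, N_E) = 1`), applied to `E = W^δ`, gives
`w(W^d) = χ₄(m) · J(N_{W^δ} | m) · w(W^δ)` (`rootNumber_quadraticTwist_mul_χ₄_mul`). For fixed `δ`
the deviation of `#{m ≤ Y : w = +1}` from half the count is therefore `± ½ ∑_{m ≤ Y squarefree}
χ₄(m) J(a | m)` with `a = N_{W^δ} Q²` (the factor `J(Q | m)²` enforces `(m, Q) = 1`). The summand is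
periodic mod `4a`, completely multiplicative and takes the value `−1` at `4a − 1` (quadratic
reciprocity), so its sum over a period vanishes and its partial sums are bounded by `4a`
(`abs_sum_range_χ₄_mul_jacobiSym_le`); with `μ²(m) = ∑_{k² ∣ m} μ(k)` the sum over the squarefree
`m ≤ Y` is at most `4a √Y` (`abs_sum_squarefree_χ₄_mul_jacobiSym_le`). Summing over the finitely
many `δ`: `|2 #{d : w(W^d) = 1} − #{d}| ≤ C_W √X` over the squarefree `|d| ≤ X`
(`abs_two_mul_card_rootNumber_sub_card_le`), and the density `1/2` follows since `#{d} ≥ X/4`.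

Everything is proved; no definitions and no named facts are introduced (D-0026).

## References

* [arXiv250317619] A. Smith, *The Birch and Swinnerton-Dyer conjecture implies Goldfeld's
  conjecture*, arXiv:2503.17619 (2025), Thm. 1.1 and display (1.2)
  (`(-1)^{r_{2^∞}(E^d)} = w(E^d)`, Monsky).
* [MurtyMurty1997] M. R. Murty, V. K. Murty, *Non-vanishing of `L`-functions and applications*,
  Progress in Math. 157 (1997), Ch. 6, §1 (functional equation and sign of `L_D(s, f)`).
* [DokchitserDokchitserAnnals2010] T. Dokchitser, V. Dokchitser, *On the Birch–Swinnerton-Dyer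
  quotients modulo squares*, Ann. of Math. 172 (2010), §4.6 (2-parity, after Monsky 1996).
-/

noncomputable section

open Finset
open scoped NumberTheorySymbols Classical
open Filter Topology ZMod

namespace Literature.NumberTheory.EllipticCurves


/-! ### The quadratic character `m ↦ χ₄(m) (a / m)`: period, multiplicativity, a value `-1` -/

/-- `m ↦ χ₄(m) J(a | m)` has period `4a` (`J(a | ·)` has period `4a` on odd arguments,
`χ₄` kills the even ones). [folklore] -/
theorem periodic_χ₄_mul_jacobiSym (a : ℕ) :
    Function.Periodic (fun m : ℕ ↦ χ₄ (m : ZMod 4) * J(a | m)) (4 * a) := by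
  intro m
  simp only
  have h4 : χ₄ ((m + 4 * a : ℕ) : ZMod 4) = χ₄ (m : ZMod 4) := by
    rw [χ₄_nat_mod_four (m + 4 * a), χ₄_nat_mod_four m, Nat.add_mul_mod_self_left]
  rcases Nat.even_or_odd m with he | ho
  · have h0 : χ₄ (m : ZMod 4) = 0 := by
      rw [χ₄_nat_eq_if_mod_four, if_pos (Nat.even_iff.mp he)]
    rw [h4, h0, zero_mul, zero_mul]
  · have he4 : Even (4 * a) := ⟨2 * a, by ring⟩
    have ho' : Odd (m + 4 * a) := ho.add_even he4
    rw [h4, jacobiSym.mod_right' a ho', jacobiSym.mod_right' a ho, Nat.add_mod_right]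

/-- `m ↦ χ₄(m) J(a | m)` is completely multiplicative on `ℕ`. [folklore] -/
theorem χ₄_mul_jacobiSym_mul (a m₁ m₂ : ℕ) :
    χ₄ ((m₁ * m₂ : ℕ) : ZMod 4) * J(a | m₁ * m₂) =
      (χ₄ (m₁ : ZMod 4) * J(a | m₁)) * (χ₄ (m₂ : ZMod 4) * J(a | m₂)) := by
  rcases eq_or_ne m₁ 0 with rfl | h₁
  · simp
  rcases eq_or_ne m₂ 0 with rfl | h₂
  · simp
  rw [Nat.cast_mul, map_mul, jacobiSym.mul_right' _ h₁ h₂]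
  ring

/-- `|χ₄(m) J(a | m)| ≤ 1`. [folklore] -/
theorem abs_χ₄_mul_jacobiSym_le (a m : ℕ) : |χ₄ (m : ZMod 4) * J(a | m)| ≤ 1 := by
  rw [abs_mul]
  have h1 : |χ₄ (m : ZMod 4)| ≤ 1 := by
    rw [χ₄_nat_eq_if_mod_four]
    split_ifs <;> simp
  have h2 : |J(a | m)| ≤ 1 := by
    rcases jacobiSym.trichotomy a m with h | h | h <;> rw [h] <;> simp
  calc |χ₄ (m : ZMod 4)| * |J(a | m)| ≤ 1 * 1 :=
        mul_le_mul h1 h2 (abs_nonneg _) zero_le_one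
    _ = 1 := one_mul _

/-- The value at `4a - 1` is `-1` (`a ≥ 1`): `χ₄(4a-1) = -1` and `J(a | 4a-1) = 1` by quadratic
reciprocity (write `a = 2^e a₁`, `a₁` odd: `J(2 | 4a-1)^e = 1` as `4a - 1 ≡ 7 (mod 8)` when `e ≥ 1`,
and `J(a₁ | 4a-1) = ± J(-1 | a₁) = ± χ₄(a₁) = 1`). [folklore] -/
theorem χ₄_mul_jacobiSym_pred {a : ℕ} (ha : 0 < a) :
    χ₄ ((4 * a - 1 : ℕ) : ZMod 4) * J(a | 4 * a - 1) = -1 := by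
  set b : ℕ := 4 * a - 1 with hb
  have hb3 : b % 4 = 3 := by omega
  have hbodd : Odd b := Nat.odd_iff.mpr (by omega)
  rw [χ₄_nat_three_mod_four hb3]
  suffices h : J(a | b) = 1 by rw [h]; norm_num
  obtain ⟨e, a₁, ha₁, hae⟩ := Nat.exists_eq_pow_mul_and_not_dvd ha.ne' 2 (by norm_num)
  have ha₁odd : Odd a₁ := Nat.odd_iff.mpr (Nat.two_dvd_ne_zero.mp ha₁)
  have ha₁pos : 0 < a₁ := ha₁odd.pos
  -- `J(2 | b) ^ e = 1`
  have h2 : J(2 | b) ^ e = 1 := by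
    rcases Nat.eq_zero_or_pos e with he | he
    · rw [he, pow_zero]
    · have hb8 : b % 8 = 7 := by
        have h2a : 2 ∣ a := by
          rw [hae]; exact dvd_mul_of_dvd_left (dvd_pow_self 2 he.ne') _
        obtain ⟨c, hc⟩ := h2a
        omega
      rw [jacobiSym.at_two hbodd, χ₈_nat_eq_if_mod_eight, if_neg (by omega), if_pos (Or.inr hb8), one_pow]
  -- `J(a₁ | b) = 1`
  have hba₁ : (b : ℤ) % a₁ = (-1 : ℤ) % a₁ := by
    have : (b : ℤ) = -1 + a₁ * (4 * 2 ^ e) := by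
      have h1 : 1 ≤ 4 * a := by omega
      rw [hb, Nat.cast_sub h1]
      push_cast
      rw [hae]
      push_cast
      ring
    rw [this, Int.add_mul_emod_self_left]
  have h1 : J(a₁ | b) = 1 := by
    rcases Nat.odd_mod_four_iff.mp (Nat.odd_iff.mp ha₁odd) with h41 | h43
    · rw [jacobiSym.quadratic_reciprocity_one_mod_four h41 hbodd, jacobiSym.mod_left' hba₁,
        jacobiSym.at_neg_one ha₁odd, χ₄_nat_one_mod_four h41]
    · rw [jacobiSym.quadratic_reciprocity_three_mod_four h43 hb3, jacobiSym.mod_left' hba₁,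
        jacobiSym.at_neg_one ha₁odd, χ₄_nat_three_mod_four h43]
      norm_num
  have : ((a : ℕ) : ℤ) = ((2 : ℕ) : ℤ) ^ e * (a₁ : ℤ) := by rw [hae]; push_cast; ring
  rw [this, jacobiSym.mul_left, jacobiSym.pow_left, Nat.cast_ofNat, h2, h1, one_mul]

/-- **The sum over a period vanishes**: `∑_{m < 4a} χ₄(m) J(a | m) = 0` — multiplication by the unit
`4a - 1` permutes the residues mod `4a` and multiplies the summand by `-1`. [folklore] -/
theorem sum_range_χ₄_mul_jacobiSym {a : ℕ} (ha : 0 < a) :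
    ∑ m ∈ range (4 * a), χ₄ (m : ZMod 4) * J(a | m) = 0 := by
  set P : ℕ := 4 * a with hP
  have hP0 : 0 < P := by omega
  set m₀ : ℕ := 4 * a - 1 with hm₀
  -- `m₀² ≡ 1 (mod P)`
  have hsq : m₀ * m₀ % P = 1 % P := by
    obtain ⟨c, hc⟩ : ∃ c, P = c + 2 := ⟨4 * a - 2, by omega⟩
    have hm : m₀ = c + 1 := by omega
    rw [hm, hc, show (c + 1) * (c + 1) = 1 + (c + 2) * c by ring, Nat.add_mul_mod_self_left]
  have hper := periodic_χ₄_mul_jacobiSym a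
  -- reindex the sum along `m ↦ m₀ m % P`
  have hre : ∑ m ∈ range P, χ₄ ((m₀ * m % P : ℕ) : ZMod 4) * J(a | m₀ * m % P) =
      ∑ m ∈ range P, χ₄ (m : ZMod 4) * J(a | m) := by
    refine sum_nbij' (fun m ↦ m₀ * m % P) (fun m ↦ m₀ * m % P) (fun m _ ↦ mem_range.mpr (Nat.mod_lt _ hP0))
      (fun m _ ↦ mem_range.mpr (Nat.mod_lt _ hP0)) (fun m hm ↦ ?_) (fun m hm ↦ ?_) (fun m _ ↦ rfl)
    all_goals
      rw [mem_range] at hm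
      rw [Nat.mul_mod, Nat.mod_mod, ← Nat.mul_mod, ← mul_assoc, Nat.mul_mod, hsq, ← Nat.mul_mod, one_mul,
        Nat.mod_eq_of_lt hm]
  -- and compare with the multiplicativity
  have hmul : ∑ m ∈ range P, χ₄ ((m₀ * m % P : ℕ) : ZMod 4) * J(a | m₀ * m % P) =
      -∑ m ∈ range P, χ₄ (m : ZMod 4) * J(a | m) := by
    rw [← neg_one_mul, mul_sum]
    refine sum_congr rfl fun m _ ↦ ?_
    have h := hper.map_mod_nat (m₀ * m)
    have hv : χ₄ (m₀ : ZMod 4) * J(a | m₀) = -1 := χ₄_mul_jacobiSym_pred ha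
    rw [h, χ₄_mul_jacobiSym_mul, hv]
  have h := hre.symm.trans hmul
  linarith

/-- Sums over any window of one period agree. [folklore] -/
theorem sum_range_add_χ₄_mul_jacobiSym (a n : ℕ) :
    ∑ m ∈ range (4 * a), χ₄ ((n + m : ℕ) : ZMod 4) * J(a | n + m) =
      ∑ m ∈ range (4 * a), χ₄ (m : ZMod 4) * J(a | m) := by
  induction n with
  | zero => simp
  | succ n ih =>
    have hper := periodic_χ₄_mul_jacobiSym a n
    simp only at hper
    have h1 := sum_range_succ (fun m ↦ χ₄ ((n + m : ℕ) : ZMod 4) * J(a | n + m)) (4 * a)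
    have h2 := sum_range_succ' (fun m ↦ χ₄ ((n + m : ℕ) : ZMod 4) * J(a | n + m)) (4 * a)
    simp only [add_zero] at h2
    rw [hper] at h1
    have h3 : ∑ m ∈ range (4 * a), χ₄ ((n + 1 + m : ℕ) : ZMod 4) * J(a | n + 1 + m) =
        ∑ m ∈ range (4 * a), χ₄ ((n + (m + 1) : ℕ) : ZMod 4) * J(a | n + (m + 1)) := by
      refine sum_congr rfl fun m _ ↦ ?_
      rw [show n + 1 + m = n + (m + 1) by ring]
    rw [h3]
    linarith

/-- **Partial sums are bounded by the period**: `|∑_{m < n} χ₄(m) J(a | m)| ≤ 4a`. [folklore] -/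
theorem abs_sum_range_χ₄_mul_jacobiSym_le {a : ℕ} (ha : 0 < a) (n : ℕ) :
    |∑ m ∈ range n, χ₄ (m : ZMod 4) * J(a | m)| ≤ 4 * a := by
  set P : ℕ := 4 * a with hP
  have hP0 : 0 < P := by omega
  -- `S (n + P) = S n`
  have hstep : ∀ n, ∑ m ∈ range (n + P), χ₄ (m : ZMod 4) * J(a | m) =
      ∑ m ∈ range n, χ₄ (m : ZMod 4) * J(a | m) := by
    intro n
    rw [sum_range_add, sum_range_add_χ₄_mul_jacobiSym, sum_range_χ₄_mul_jacobiSym ha, add_zero]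
  -- `S n = S (n % P)`
  have hmod : ∀ k r, ∑ m ∈ range (r + P * k), χ₄ (m : ZMod 4) * J(a | m) =
      ∑ m ∈ range r, χ₄ (m : ZMod 4) * J(a | m) := by
    intro k
    induction k with
    | zero => intro r; simp
    | succ k ih => intro r; rw [show r + P * (k + 1) = (r + P * k) + P by ring, hstep, ih]
  have hn : n = n % P + P * (n / P) := (Nat.mod_add_div n P).symm
  rw [hn, hmod]
  calc |∑ m ∈ range (n % P), χ₄ (m : ZMod 4) * J(a | m)|
      ≤ ∑ m ∈ range (n % P), |χ₄ (m : ZMod 4) * J(a | m)| := abs_sum_le_sum_abs _ _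
    _ ≤ ∑ _m ∈ range (n % P), (1 : ℤ) := sum_le_sum fun m _ ↦ abs_χ₄_mul_jacobiSym_le a m
    _ = (n % P : ℕ) := by simp
    _ ≤ 4 * a := by rw [hP]; exact_mod_cast (Nat.mod_lt n hP0).le

/-- The same bound for the sums over `1 ≤ m ≤ Z`. [folklore] -/
theorem abs_sum_Icc_χ₄_mul_jacobiSym_le {a : ℕ} (ha : 0 < a) (Z : ℕ) :
    |∑ m ∈ Icc 1 Z, χ₄ (m : ZMod 4) * J(a | m)| ≤ 4 * a := by
  have h : ∑ m ∈ Icc 1 Z, χ₄ (m : ZMod 4) * J(a | m) = ∑ m ∈ range (Z + 1), χ₄ (m : ZMod 4) * J(a | m) := by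
    rw [range_eq_Ico, sum_eq_sum_Ico_succ_bot (show 0 < Z + 1 by omega), zero_add,
      Finset.Ico_add_one_right_eq_Icc]
    simp
  rw [h]
  exact abs_sum_range_χ₄_mul_jacobiSym_le ha (Z + 1)

/-! ### Möbius over the squares: `∑_{k² ∣ m} μ(k) = [m squarefree]` -/

/-- `k² ∣ s t²` with `s` squarefree forces `k ∣ t`. [folklore] -/
theorem dvd_of_sq_dvd_mul_sq {k s t : ℕ} (hs : Squarefree s) (ht : 0 < t) (h : k ^ 2 ∣ s * t ^ 2) : k ∣ t := by
  rcases Nat.eq_zero_or_pos k with rfl | hk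
  · rw [zero_pow two_ne_zero, zero_dvd_iff, mul_eq_zero] at h
    rcases h with h | h
    · exact absurd h hs.ne_zero
    · exact absurd h (pow_ne_zero 2 ht.ne')
  obtain ⟨k', t', hco, hk', ht'⟩ := Nat.exists_coprime k t
  set g := Nat.gcd k t with hg
  have hg0 : 0 < g := Nat.gcd_pos_of_pos_left t hk
  have h1 : k' ^ 2 ∣ s * t' ^ 2 := by
    have h' : (k' * g) ^ 2 ∣ s * (t' * g) ^ 2 := by rw [← hk', ← ht']; exact h
    rw [mul_pow, mul_pow, ← mul_assoc] at h'
    exact Nat.dvd_of_mul_dvd_mul_right (pow_pos hg0 2) h'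
  have h2 : k' ^ 2 ∣ s := (Nat.Coprime.pow 2 2 hco).dvd_of_dvd_mul_right h1
  have h3 : IsUnit k' := hs k' (by rw [← sq]; exact h2)
  rw [Nat.isUnit_iff] at h3
  rw [hk', h3, one_mul, ht']
  exact Nat.dvd_mul_left g t'

/-- **`∑_{k ≥ 1, k² ∣ m} μ(k) = 1` if `m` is squarefree and `0` otherwise** (`m ≥ 1`; the `k` may be
taken in any range `[1, Y]` with `Y ≥ m`): writing `m = s t²` with `s` squarefree, `k² ∣ m` iff `k ∣ t`.
[folklore] -/
theorem sum_moebius_filter_sq_dvd {m Y : ℕ} (hm : 0 < m) (hmY : m ≤ Y) :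
    ∑ k ∈ (Icc 1 Y).filter (fun k ↦ k ^ 2 ∣ m), (ArithmeticFunction.moebius k : ℤ) =
      if Squarefree m then 1 else 0 := by
  obtain ⟨s, t, hs0, ht0, hst, hs⟩ := Nat.sq_mul_squarefree_of_pos hm
  -- the `k` with `k² ∣ m` are the divisors of `t`
  have hset : (Icc 1 Y).filter (fun k ↦ k ^ 2 ∣ m) = t.divisors := by
    ext k
    simp only [mem_filter, mem_Icc, Nat.mem_divisors]
    constructor
    · rintro ⟨-, hk⟩
      refine ⟨dvd_of_sq_dvd_mul_sq hs ht0 ?_, ht0.ne'⟩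
      rw [mul_comm]; rwa [hst]
    · rintro ⟨hk, -⟩
      have hkpos : 0 < k := Nat.pos_of_dvd_of_pos hk ht0
      refine ⟨⟨hkpos, ?_⟩, ?_⟩
      · calc k ≤ t := Nat.le_of_dvd ht0 hk
          _ ≤ t ^ 2 * s := by nlinarith
          _ = m := hst
          _ ≤ Y := hmY
      · rw [← hst]
        exact Dvd.dvd.mul_right (pow_dvd_pow_of_dvd hk 2) s
  -- `∑_{d ∣ t} μ(d) = [t = 1]` (`μ * ζ = 1`; cf. `sum_divisors_intCast_moebius_eq_ite` in
  -- `GaloisRepresentations/FrobeniusDensityTheorem`, not imported here)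
  have hμ : ∑ d ∈ t.divisors, (ArithmeticFunction.moebius d : ℤ) = if t = 1 then 1 else 0 := by
    have h := congrArg (fun f : ArithmeticFunction ℤ ↦ f t) ArithmeticFunction.moebius_mul_coe_zeta
    simpa only [ArithmeticFunction.coe_mul_zeta_apply, ArithmeticFunction.one_apply] using h
  rw [hset, hμ]
  -- `t = 1 ↔ m` squarefree
  by_cases ht1 : t = 1
  · rw [if_pos ht1, if_pos]
    rw [← hst, ht1, one_pow, one_mul]
    exact hs
  · rw [if_neg ht1, if_neg]
    intro hsq
    rw [← hst] at hsq
    have : IsUnit t := hsq t ⟨s, by ring⟩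
    exact ht1 (Nat.isUnit_iff.mp this)

/-- **The character sum over the squarefree integers**:
`|∑_{1 ≤ m ≤ Y, m squarefree} χ₄(m) J(a | m)| ≤ 4a √Y`. Möbius: `μ²(m) = ∑_{k² ∣ m} μ(k)`, the
multiples of `k²` in `[1, Y]` are the `k² j`, `j ≤ Y/k²`, the summand is completely multiplicative,
and each inner sum is at most `4a` in absolute value and empty once `k² > Y`. [folklore] -/
theorem abs_sum_squarefree_χ₄_mul_jacobiSym_le {a : ℕ} (ha : 0 < a) (Y : ℕ) :
    |∑ m ∈ (Icc 1 Y).filter Squarefree, χ₄ (m : ZMod 4) * J(a | m)| ≤ 4 * a * Nat.sqrt Y := by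
  set F : ℕ → ℤ := fun m ↦ χ₄ (m : ZMod 4) * J(a | m) with hF
  -- Möbius
  have h1 : ∑ m ∈ (Icc 1 Y).filter Squarefree, F m =
      ∑ m ∈ Icc 1 Y, ∑ k ∈ (Icc 1 Y).filter (fun k ↦ k ^ 2 ∣ m), (ArithmeticFunction.moebius k : ℤ) * F m := by
    rw [sum_filter]
    refine sum_congr rfl fun m hm ↦ ?_
    rw [mem_Icc] at hm
    rw [← sum_mul, sum_moebius_filter_sq_dvd hm.1 hm.2]
    split_ifs <;> simp
  -- swap
  have h2 : ∑ m ∈ Icc 1 Y, ∑ k ∈ (Icc 1 Y).filter (fun k ↦ k ^ 2 ∣ m), (ArithmeticFunction.moebius k : ℤ) * F m =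
      ∑ k ∈ Icc 1 Y, (ArithmeticFunction.moebius k : ℤ) *
        ∑ m ∈ (Icc 1 Y).filter (fun m ↦ k ^ 2 ∣ m), F m := by
    simp_rw [sum_filter, mul_sum]
    rw [sum_comm]
    refine sum_congr rfl fun k _ ↦ sum_congr rfl fun m _ ↦ ?_
    split_ifs <;> simp
  -- multiples of `k²`
  have h3 : ∀ k ∈ Icc 1 Y, ∑ m ∈ (Icc 1 Y).filter (fun m ↦ k ^ 2 ∣ m), F m =
      F k * F k * ∑ j ∈ Icc 1 (Y / k ^ 2), F j := by
    intro k hk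
    rw [mem_Icc] at hk
    have hk2 : 0 < k ^ 2 := pow_pos hk.1 2
    have himg : (Icc 1 Y).filter (fun m ↦ k ^ 2 ∣ m) = (Icc 1 (Y / k ^ 2)).image (fun j ↦ k ^ 2 * j) := by
      ext m
      simp only [mem_filter, mem_Icc, mem_image]
      constructor
      · rintro ⟨⟨hm1, hmY⟩, j, rfl⟩
        refine ⟨j, ⟨?_, ?_⟩, rfl⟩
        · rcases Nat.eq_zero_or_pos j with rfl | hj
          · omega
          · exact hj
        · rw [Nat.le_div_iff_mul_le hk2, mul_comm]; exact hmY
      · rintro ⟨j, ⟨hj1, hjY⟩, rfl⟩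
        refine ⟨⟨Nat.mul_pos hk2 hj1, ?_⟩, dvd_mul_right _ _⟩
        rw [Nat.le_div_iff_mul_le hk2] at hjY
        rw [mul_comm]; exact hjY
    rw [himg, sum_image (fun x _ y _ hxy ↦ Nat.eq_of_mul_eq_mul_left hk2 hxy), mul_sum]
    refine sum_congr rfl fun j _ ↦ ?_
    simp only [hF]
    rw [sq, χ₄_mul_jacobiSym_mul, χ₄_mul_jacobiSym_mul]
  rw [h1, h2]
  calc |∑ k ∈ Icc 1 Y, (ArithmeticFunction.moebius k : ℤ) * ∑ m ∈ (Icc 1 Y).filter (fun m ↦ k ^ 2 ∣ m), F m|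
      ≤ ∑ k ∈ Icc 1 Y, |(ArithmeticFunction.moebius k : ℤ) * ∑ m ∈ (Icc 1 Y).filter (fun m ↦ k ^ 2 ∣ m), F m| :=
        abs_sum_le_sum_abs _ _
    _ ≤ ∑ k ∈ Icc 1 Y, (if k ^ 2 ≤ Y then (4 * a : ℤ) else 0) := by
        refine sum_le_sum fun k hk ↦ ?_
        rw [h3 k hk, abs_mul, abs_mul]
        have hμ : |(ArithmeticFunction.moebius k : ℤ)| ≤ 1 := by
          have := ArithmeticFunction.abs_moebius_le_one (n := k)
          exact_mod_cast this
        have hFk : |F k * F k| ≤ 1 := by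
          rw [abs_mul]
          calc |F k| * |F k| ≤ 1 * 1 :=
                mul_le_mul (abs_χ₄_mul_jacobiSym_le a k) (abs_χ₄_mul_jacobiSym_le a k) (abs_nonneg _) zero_le_one
            _ = 1 := one_mul _
        split_ifs with hkY
        · calc |(ArithmeticFunction.moebius k : ℤ)| * (|F k * F k| * |∑ j ∈ Icc 1 (Y / k ^ 2), F j|)
              ≤ 1 * (1 * (4 * a)) := by
                refine mul_le_mul hμ (mul_le_mul hFk (abs_sum_Icc_χ₄_mul_jacobiSym_le ha _) (abs_nonneg _)
                  zero_le_one) (by positivity) zero_le_one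
            _ = 4 * a := by ring
        · have hY : Y / k ^ 2 = 0 := Nat.div_eq_of_lt (by omega)
          rw [hY]
          simp
    _ = 4 * a * Nat.sqrt Y := by
        rw [← sum_filter]
        have hS : (Icc 1 Y).filter (fun k ↦ k ^ 2 ≤ Y) = Icc 1 (Nat.sqrt Y) := by
          ext k
          simp only [mem_filter, mem_Icc, Nat.le_sqrt']
          constructor
          · rintro ⟨⟨h1, -⟩, h2⟩; exact ⟨h1, h2⟩
          · rintro ⟨h1, h2⟩; exact ⟨⟨h1, le_trans (by nlinarith) h2⟩, h2⟩
        rw [hS, sum_const, Nat.card_Icc, Nat.add_sub_cancel, nsmul_eq_mul]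
        ring


/-! ### The decomposition `d = δ · χ₄(m) · m` of a squarefree integer along an even modulus `Q` -/

/-- `χ₄(m)² = 1` for odd `m`. [folklore] -/
theorem χ₄_mul_χ₄_of_odd {m : ℕ} (hm : Odd m) : χ₄ (m : ZMod 4) * χ₄ (m : ZMod 4) = 1 := by
  rcases Nat.odd_mod_four_iff.mp (Nat.odd_iff.mp hm) with h | h
  · rw [χ₄_nat_one_mod_four h]; norm_num
  · rw [χ₄_nat_three_mod_four h]; norm_num

/-- `|χ₄(m)| = 1` for odd `m`. [folklore] -/
theorem natAbs_χ₄_of_odd {m : ℕ} (hm : Odd m) : (χ₄ (m : ZMod 4)).natAbs = 1 := by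
  rcases Nat.odd_mod_four_iff.mp (Nat.odd_iff.mp hm) with h | h
  · rw [χ₄_nat_one_mod_four h]; rfl
  · rw [χ₄_nat_three_mod_four h]; rfl

/-- An integer prime to an even modulus is odd. [folklore] -/
theorem odd_of_coprime_of_two_dvd {m Q : ℕ} (h2 : 2 ∣ Q) (hm : m.Coprime Q) : Odd m :=
  Nat.coprime_two_right.mp (hm.coprime_dvd_right h2)

/-- **Existence of the decomposition.** For a squarefree integer `d` and `Q ≥ 1` even, put
`g = gcd(d, Q)`, `m = |d| / g` and `δ = sign(d) χ₄(m) g`: then `m ≥ 1` is squarefree and prime to `Q`,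
`δ` is a squarefree divisor of `Q` with `|δ| = g`, and `d = δ χ₄(m) m`. [folklore] -/
theorem exists_eq_mul_χ₄_mul {Q : ℕ} (h2 : 2 ∣ Q) {d : ℤ} (hd : Squarefree d) :
    ∃ (δ : ℤ) (m : ℕ), Squarefree δ ∧ δ ∣ (Q : ℤ) ∧ 0 < m ∧ Squarefree m ∧ m.Coprime Q ∧
      δ.natAbs * m = d.natAbs ∧ δ * χ₄ (m : ZMod 4) * m = d := by
  have hd0 : d ≠ 0 := hd.ne_zero
  set n : ℕ := d.natAbs with hn
  have hn0 : 0 < n := Int.natAbs_pos.mpr hd0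
  have hnsq : Squarefree n := Int.squarefree_natAbs.mpr hd
  set g : ℕ := Nat.gcd n Q with hg
  have hg0 : 0 < g := Nat.gcd_pos_of_pos_left Q hn0
  obtain ⟨m, hm⟩ : g ∣ n := Nat.gcd_dvd_left n Q
  have hm0 : 0 < m := by
    rcases Nat.eq_zero_or_pos m with rfl | h
    · rw [mul_zero] at hm; omega
    · exact h
  obtain ⟨hgm, hgsq, hmsq⟩ := Nat.squarefree_mul_iff.mp (hm ▸ hnsq)
  have hcop : m.Coprime Q := by
    have hc : Nat.gcd m Q ∣ 1 := by
      rw [← hgm]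
      refine Nat.dvd_gcd ?_ (Nat.gcd_dvd_left m Q)
      rw [hg]
      exact Nat.dvd_gcd ((Nat.gcd_dvd_left m Q).trans ⟨g, by rw [hm, mul_comm]⟩) (Nat.gcd_dvd_right m Q)
    exact Nat.dvd_one.mp hc
  have hmodd : Odd m := odd_of_coprime_of_two_dvd h2 hcop
  refine ⟨d.sign * χ₄ (m : ZMod 4) * g, m, ?_, ?_, hm0, hmsq, hcop, ?_, ?_⟩
  · rw [← Int.squarefree_natAbs, Int.natAbs_mul, Int.natAbs_mul, Int.natAbs_sign_of_ne_zero hd0,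
      natAbs_χ₄_of_odd hmodd, one_mul, one_mul, Int.natAbs_natCast]
    exact hgsq
  · rw [← Int.natAbs_dvd_natAbs, Int.natAbs_mul, Int.natAbs_mul, Int.natAbs_sign_of_ne_zero hd0,
      natAbs_χ₄_of_odd hmodd, one_mul, one_mul, Int.natAbs_natCast, Int.natAbs_natCast]
    exact Nat.gcd_dvd_right n Q
  · rw [Int.natAbs_mul, Int.natAbs_mul, Int.natAbs_sign_of_ne_zero hd0, natAbs_χ₄_of_odd hmodd, one_mul,
      one_mul, Int.natAbs_natCast, hm]
  · calc d.sign * χ₄ (m : ZMod 4) * g * χ₄ (m : ZMod 4) * m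
        = d.sign * (χ₄ (m : ZMod 4) * χ₄ (m : ZMod 4)) * ((g * m : ℕ) : ℤ) := by push_cast; ring
      _ = d := by rw [χ₄_mul_χ₄_of_odd hmodd, mul_one, ← hm, hn, Int.sign_mul_natAbs]

/-- **Uniqueness of the decomposition**: `δ χ₄(m) m = δ' χ₄(m') m'` with `δ, δ'` divisors of the even
`Q ≥ 1` and `m, m' ≥ 1` prime to `Q` forces `δ = δ'` and `m = m'` (`|δ| = gcd(|d|, Q)`). [folklore] -/
theorem eq_of_mul_χ₄_mul_eq {Q : ℕ} (hQ : 0 < Q) (h2 : 2 ∣ Q) {δ δ' : ℤ} {m m' : ℕ} (hδ : δ ∣ (Q : ℤ))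
    (hδ' : δ' ∣ (Q : ℤ)) (hmQ : m.Coprime Q) (hm'Q : m'.Coprime Q)
    (h : δ * χ₄ (m : ZMod 4) * m = δ' * χ₄ (m' : ZMod 4) * m') : δ = δ' ∧ m = m' := by
  have hmodd : Odd m := odd_of_coprime_of_two_dvd h2 hmQ
  have hm'odd : Odd m' := odd_of_coprime_of_two_dvd h2 hm'Q
  have hδ0 : δ ≠ 0 := by
    rintro rfl
    rw [zero_dvd_iff] at hδ
    exact hQ.ne' (by exact_mod_cast hδ)
  -- absolute values: `|δ| m = |δ'| m'`
  have habs : δ.natAbs * m = δ'.natAbs * m' := by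
    have := congrArg Int.natAbs h
    rwa [Int.natAbs_mul, Int.natAbs_mul, Int.natAbs_mul, Int.natAbs_mul, natAbs_χ₄_of_odd hmodd,
      natAbs_χ₄_of_odd hm'odd, mul_one, mul_one, Int.natAbs_natCast, Int.natAbs_natCast] at this
  -- gcd with `Q`: `|δ| = |δ'|`
  have hgcd : ∀ {e : ℤ} {k : ℕ}, e ∣ (Q : ℤ) → k.Coprime Q → Nat.gcd (e.natAbs * k) Q = e.natAbs := by
    intro e k he hk
    rw [Nat.Coprime.gcd_mul_right_cancel _ hk]
    exact Nat.gcd_eq_left (Int.natAbs_dvd_natAbs.mpr he)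
  have hδδ' : δ.natAbs = δ'.natAbs := by rw [← hgcd hδ hmQ, habs, hgcd hδ' hm'Q]
  have hmm' : m = m' := by
    rw [hδδ'] at habs
    exact Nat.eq_of_mul_eq_mul_left (Nat.pos_of_ne_zero (hδδ' ▸ Int.natAbs_ne_zero.mpr hδ0)) habs
  subst hmm'
  refine ⟨?_, rfl⟩
  have hne : (χ₄ (m : ZMod 4) : ℤ) * m ≠ 0 := by
    refine mul_ne_zero ?_ (by exact_mod_cast hmodd.pos.ne')
    intro h0
    have := natAbs_χ₄_of_odd hmodd
    rw [h0] at this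
    simp at this
  rw [mul_assoc, mul_assoc] at h
  exact mul_right_cancel₀ hne h

/-- The absolute value of `δ χ₄(m) m` is `|δ| m` for odd `m`. [folklore] -/
theorem natAbs_mul_χ₄_mul {δ : ℤ} {m : ℕ} (hm : Odd m) :
    (δ * χ₄ (m : ZMod 4) * m).natAbs = δ.natAbs * m := by
  rw [Int.natAbs_mul, Int.natAbs_mul, natAbs_χ₄_of_odd hm, mul_one, Int.natAbs_natCast]

/-- `δ χ₄(m) m` is squarefree for `δ` a squarefree divisor of `Q` and `m` squarefree prime to the even
`Q`. [folklore] -/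
theorem squarefree_mul_χ₄_mul {Q : ℕ} (h2 : 2 ∣ Q) {δ : ℤ} {m : ℕ} (hδ : Squarefree δ)
    (hδQ : δ ∣ (Q : ℤ)) (hm : Squarefree m) (hmQ : m.Coprime Q) :
    Squarefree (δ * χ₄ (m : ZMod 4) * m) := by
  have hmodd : Odd m := odd_of_coprime_of_two_dvd h2 hmQ
  rw [← Int.squarefree_natAbs, natAbs_mul_χ₄_mul hmodd, Nat.squarefree_mul_iff]
  refine ⟨?_, Int.squarefree_natAbs.mpr hδ, hm⟩
  have h : δ.natAbs ∣ Q := by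
    have := Int.natAbs_dvd_natAbs.mpr hδQ
    rwa [Int.natAbs_natCast] at this
  exact (hmQ.coprime_dvd_right h).symm

/-- **Counting squarefree integers along the decomposition `d = δ χ₄(m) m`.** For `Q ≥ 1` even, a
predicate `P` and `X ≥ 0`:
`#{d squarefree, |d| ≤ X, P d} = ∑_δ #{1 ≤ m ≤ X/|δ| : m squarefree, (m, Q) = 1, P(δ χ₄(m) m)}`,
the sum over the squarefree divisors `δ` (of both signs) of `Q`. [folklore] -/
theorem card_filter_squarefree_eq_sum_card {Q : ℕ} (hQ : 0 < Q) (h2 : 2 ∣ Q) (P : ℤ → Prop)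
    [DecidablePred P] (X : ℕ) :
    ((Icc (-(X : ℤ)) X).filter fun d ↦ Squarefree d ∧ P d).card =
      ∑ δ ∈ (Icc (-(Q : ℤ)) Q).filter (fun δ ↦ Squarefree δ ∧ δ ∣ (Q : ℤ)),
        ((Icc 1 (X / δ.natAbs)).filter fun m : ℕ ↦
          Squarefree m ∧ m.Coprime Q ∧ P (δ * χ₄ (m : ZMod 4) * m)).card := by
  set T := (Icc (-(Q : ℤ)) Q).filter (fun δ ↦ Squarefree δ ∧ δ ∣ (Q : ℤ)) with hT
  set M : ℤ → Finset ℕ := fun δ ↦ (Icc 1 (X / δ.natAbs)).filter fun m : ℕ ↦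
      Squarefree m ∧ m.Coprime Q ∧ P (δ * χ₄ (m : ZMod 4) * m) with hM
  have hmemT : ∀ {δ : ℤ}, δ ∈ T ↔ Squarefree δ ∧ δ ∣ (Q : ℤ) := by
    intro δ
    simp only [hT, mem_filter, mem_Icc, and_iff_right_iff_imp]
    rintro ⟨-, hδ⟩
    have h := Int.natAbs_dvd_natAbs.mpr hδ
    rw [Int.natAbs_natCast] at h
    have hle : |δ| ≤ (Q : ℤ) := by
      rw [Int.abs_eq_natAbs]
      exact_mod_cast Nat.le_of_dvd hQ h
    exact abs_le.mp hle
  have hmemM : ∀ {δ : ℤ} {m : ℕ}, m ∈ M δ ↔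
      (1 ≤ m ∧ m ≤ X / δ.natAbs) ∧ Squarefree m ∧ m.Coprime Q ∧ P (δ * χ₄ (m : ZMod 4) * m) := by
    intro δ m
    simp only [hM, mem_filter, mem_Icc]
  have key : ((Icc (-(X : ℤ)) X).filter fun d ↦ Squarefree d ∧ P d) =
      T.biUnion (fun δ ↦ (M δ).image fun m : ℕ ↦ δ * χ₄ (m : ZMod 4) * m) := by
    ext d
    simp only [mem_filter, mem_Icc, mem_biUnion, mem_image]
    constructor
    · rintro ⟨⟨hlo, hhi⟩, hsq, hP⟩
      obtain ⟨δ, m, hδsq, hδQ, hm0, hmsq, hmQ, habs, hd⟩ := exists_eq_mul_χ₄_mul h2 hsq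
      refine ⟨δ, hmemT.mpr ⟨hδsq, hδQ⟩, m, ?_, hd⟩
      rw [hmemM]
      refine ⟨⟨hm0, ?_⟩, hmsq, hmQ, by rw [hd]; exact hP⟩
      have hδ0 : 0 < δ.natAbs := Int.natAbs_pos.mpr hδsq.ne_zero
      rw [Nat.le_div_iff_mul_le hδ0, mul_comm, habs]
      have : ((d.natAbs : ℕ) : ℤ) ≤ (X : ℤ) := by
        rw [Int.natCast_natAbs]
        exact abs_le.mpr ⟨hlo, hhi⟩
      exact_mod_cast this
    · rintro ⟨δ, hδT, m, hmM, rfl⟩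
      obtain ⟨hδsq, hδQ⟩ := hmemT.mp hδT
      obtain ⟨⟨hm1, hmX⟩, hmsq, hmQ, hP⟩ := hmemM.mp hmM
      have hmodd : Odd m := odd_of_coprime_of_two_dvd h2 hmQ
      have hδ0 : 0 < δ.natAbs := Int.natAbs_pos.mpr hδsq.ne_zero
      have hle : |δ * χ₄ (m : ZMod 4) * m| ≤ (X : ℤ) := by
        rw [Int.abs_eq_natAbs, natAbs_mul_χ₄_mul hmodd]
        have : δ.natAbs * m ≤ X := by
          calc δ.natAbs * m ≤ δ.natAbs * (X / δ.natAbs) := Nat.mul_le_mul_left _ hmX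
            _ ≤ X := Nat.mul_div_le X δ.natAbs
        exact_mod_cast this
      exact ⟨abs_le.mp hle, squarefree_mul_χ₄_mul h2 hδsq hδQ hmsq hmQ, hP⟩
  have hdisj : ∀ δ ∈ T, ∀ δ' ∈ T, δ ≠ δ' →
      Disjoint ((M δ).image fun m : ℕ ↦ δ * χ₄ (m : ZMod 4) * m)
        ((M δ').image fun m : ℕ ↦ δ' * χ₄ (m : ZMod 4) * m) := by
    intro δ hδ δ' hδ' hne
    rw [Finset.disjoint_left]
    intro x hx hx'
    obtain ⟨m, hm, rfl⟩ := mem_image.mp hx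
    obtain ⟨m', hm', h⟩ := mem_image.mp hx'
    exact hne (eq_of_mul_χ₄_mul_eq hQ h2 (hmemT.mp hδ).2 (hmemT.mp hδ').2 (hmemM.mp hm).2.2.1
      (hmemM.mp hm').2.2.1 h.symm).1
  rw [key, card_biUnion hdisj]
  refine sum_congr rfl fun δ hδ ↦ ?_
  rw [card_image_of_injOn]
  intro m hm m' hm' hmm'
  exact (eq_of_mul_χ₄_mul_eq hQ h2 (hmemT.mp hδ).2 (hmemT.mp hδ).2 (hmemM.mp hm).2.2.1
    (hmemM.mp hm').2.2.1 hmm').2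


/-- **Counting all squarefree integers along the decomposition**:
`#{d squarefree, |d| ≤ X} = ∑_δ #{1 ≤ m ≤ X/|δ| : m squarefree, (m, Q) = 1}`. [folklore] -/
theorem card_filter_squarefree_eq_sum_card' {Q : ℕ} (hQ : 0 < Q) (h2 : 2 ∣ Q) (X : ℕ) :
    ((Icc (-(X : ℤ)) X).filter fun d : ℤ ↦ Squarefree d).card =
      ∑ δ ∈ (Icc (-(Q : ℤ)) Q).filter (fun δ ↦ Squarefree δ ∧ δ ∣ (Q : ℤ)),
        ((Icc 1 (X / δ.natAbs)).filter fun m : ℕ ↦ Squarefree m ∧ m.Coprime Q).card := by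
  simpa using card_filter_squarefree_eq_sum_card hQ h2 (fun _ ↦ True) X

/-! ### The conductor of `W^δ` is supported on the primes of `2 N_W δ` -/

section Support

open IsDedekindDomain IsDedekindDomain.HeightOneSpectrum NumberField Rat.HeightOneSpectrum
  Literature.NumberTheory.EllipticCurves.ModularForms WeierstrassCurve

variable (W : WeierstrassCurve ℚ) [W.IsElliptic]

/-- **The conductor of a quadratic twist is supported on the primes of `2 N_W d`**: a prime
`p ∤ 2 N_W d` does not divide `N_{W^d}`. Indeed `f_p(W) = 0` (`N_W = ∏ p^{f_p}`,
`factorization_conductorNorm_holds`), so `W` has good reduction at `p`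
(`conductorExponent_eq_zero_iff_holds`, Silverman ATAEC IV.10.2(a)); a twist by the `p`-unit `d`
keeps good reduction at the odd place `p` (`hasReductionAt_quadraticTwist_iff_of_not_dvd`,
Silverman AEC VII.5 Prop. 5.1), so `f_p(W^d) = 0` and `p ∤ N_{W^d}`.
[cite: SilvermanAEC2009, VII.5 Prop. 5.1] [cite: Silverman1994, IV.10.2(a)] -/
theorem not_dvd_conductorNorm_quadraticTwist_of_not_dvd {p : ℕ} (hp : p.Prime) (hp2 : p ≠ 2)
    (hpN : ¬ p ∣ W.conductorNorm ℤ) {d : ℤ} (hd : d ≠ 0) (hpd : ¬ (p : ℤ) ∣ d) :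
    ¬ p ∣ (W.quadraticTwist (d : ℚ)).conductorNorm ℤ := by
  haveI := W.isElliptic_quadraticTwist (show (d : ℚ) ≠ 0 by exact_mod_cast hd)
  set v : HeightOneSpectrum ℤ := (primesEquiv (R := ℤ)).symm ⟨p, hp⟩ with hv
  have hgen : natGenerator v = p :=
    congrArg (fun q : Nat.Primes ↦ (q : ℕ)) ((primesEquiv (R := ℤ)).apply_symm_apply ⟨p, hp⟩)
  have h1 : W.conductorExponent v = 0 := by
    have hf := factorization_conductorNorm_holds W v
    rw [hgen] at hf
    rw [← hf]
    exact Nat.factorization_eq_zero_of_not_dvd hpN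
  have hgood : W.HasGoodReductionAt v := (conductorExponent_eq_zero_iff_holds v W).mp h1
  have hv2 : natGenerator v ≠ 2 := by rw [hgen]; exact hp2
  have hpd' : ¬ ((natGenerator v : ℕ) : ℤ) ∣ d := by rw [hgen]; exact hpd
  have hgood' : (W.quadraticTwist (d : ℚ)).HasGoodReductionAt v :=
    (W.hasReductionAt_quadraticTwist_iff_of_not_dvd v hv2 hpd').1.mpr hgood
  have h2 : (W.quadraticTwist (d : ℚ)).conductorExponent v = 0 :=
    (conductorExponent_eq_zero_iff_holds v (W.quadraticTwist (d : ℚ))).mpr hgood'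
  intro hdvd
  have hf := factorization_conductorNorm_holds (W.quadraticTwist (d : ℚ)) v
  rw [hgen, h2] at hf
  have hpos : 0 < (W.quadraticTwist (d : ℚ)).conductorNorm ℤ :=
    WeierstrassCurve.conductorNorm_pos_holds (W.quadraticTwist (d : ℚ))
  exact (hp.factorization_pos_of_dvd hpos.ne' hdvd).ne' hf

/-- **An integer prime to `Q = 2 N_W` is prime to `N_{W^δ}` for every divisor `δ` of `Q`.** [folklore] -/
theorem coprime_conductorNorm_quadraticTwist {δ : ℤ} (hδ0 : δ ≠ 0)
    (hδQ : δ ∣ ((2 * W.conductorNorm ℤ : ℕ) : ℤ)) {m : ℕ} (hmQ : m.Coprime (2 * W.conductorNorm ℤ)) :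
    m.Coprime ((W.quadraticTwist (δ : ℚ)).conductorNorm ℤ) := by
  refine Nat.coprime_of_dvd fun p hp hpm hpN ↦ ?_
  have hpQ : ¬ p ∣ 2 * W.conductorNorm ℤ := by
    intro h
    have h1 : p ∣ Nat.gcd m (2 * W.conductorNorm ℤ) := Nat.dvd_gcd hpm h
    rw [hmQ] at h1
    exact hp.ne_one (Nat.dvd_one.mp h1)
  have hp2 : p ≠ 2 := by rintro rfl; exact hpQ (dvd_mul_right 2 _)
  have hpN' : ¬ p ∣ W.conductorNorm ℤ := fun h ↦ hpQ (dvd_mul_of_dvd_right h 2)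
  have hpd : ¬ (p : ℤ) ∣ δ := by
    intro h
    exact hpQ (by exact_mod_cast (Int.natCast_dvd_natCast.mp (h.trans hδQ)))
  exact not_dvd_conductorNorm_quadraticTwist_of_not_dvd W hp hp2 hpN' hδ0 hpd hpN

/-- **The root number along a fibre of the decomposition `d = δ χ₄(m) m`** (Murty–Murty 1997,
Ch. 6 §1, applied to the elliptic curve `W^δ` and the odd fundamental discriminant `D = χ₄(m) m`,
prime to `N_{W^δ}`): for `δ ≠ 0` dividing `Q = 2 N_W` and `m ≥ 1` squarefree prime to `Q`,
`w(W^{δ χ₄(m) m}) = χ₄(m) · (N_{W^δ} / m) · w(W^δ)`, from the Modularity Theorem.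
[cite: MurtyMurty1997, Ch. 6 §1] -/
theorem rootNumber_quadraticTwist_mul_χ₄_mul (hmod : exists_isNewformOf) {δ : ℤ} (hδ0 : δ ≠ 0)
    (hδQ : δ ∣ ((2 * W.conductorNorm ℤ : ℕ) : ℤ)) {m : ℕ} (hm : Squarefree m)
    (hmQ : m.Coprime (2 * W.conductorNorm ℤ)) :
    (W.quadraticTwist ((δ * χ₄ (m : ZMod 4) * m : ℤ) : ℚ)).rootNumber =
      χ₄ (m : ZMod 4) * J(((W.quadraticTwist (δ : ℚ)).conductorNorm ℤ : ℤ) | m) *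
        (W.quadraticTwist (δ : ℚ)).rootNumber := by
  haveI := W.isElliptic_quadraticTwist (show (δ : ℚ) ≠ 0 by exact_mod_cast hδ0)
  have hmodd : Odd m := odd_of_coprime_of_two_dvd (dvd_mul_right 2 _) hmQ
  set D : ℤ := χ₄ (m : ZMod 4) * m with hD
  have hD4 : D % 4 = 1 := by
    rcases Nat.odd_mod_four_iff.mp (Nat.odd_iff.mp hmodd) with h | h
    · rw [hD, χ₄_nat_one_mod_four h, one_mul]; omega
    · rw [hD, χ₄_nat_three_mod_four h, neg_one_mul]; omega
  have hDabs : D.natAbs = m := by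
    rw [hD, Int.natAbs_mul, natAbs_χ₄_of_odd hmodd, one_mul, Int.natAbs_natCast]
  have hDsq : Squarefree D := by rw [← Int.squarefree_natAbs, hDabs]; exact hm
  have hgcd : Int.gcd D ((W.quadraticTwist (δ : ℚ)).conductorNorm ℤ) = 1 := by
    have hc := coprime_conductorNorm_quadraticTwist W hδ0 hδQ hmQ
    rw [Int.gcd_eq_natAbs, Int.natAbs_natCast, hDabs]
    exact hc
  have h := (W.quadraticTwist (δ : ℚ)).rootNumber_quadraticTwist_of_emod_four_eq_one hmod hD4 hDsq hgcd
  rw [quadraticTwist_quadraticTwist, hDabs, jacobiSym.at_neg_one hmodd] at h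
  have hcast : ((δ : ℚ) * (D : ℚ)) = ((δ * χ₄ (m : ZMod 4) * m : ℤ) : ℚ) := by
    rw [hD]; push_cast; ring
  rw [hcast] at h
  exact h.1

end Support

/-! ### Assembly: `|2 #{d : w(W^d) = +1} − #{d}| ≤ C_W √X` over the squarefree `|d| ≤ X` -/

section Assembly

open Literature.NumberTheory.EllipticCurves.ModularForms WeierstrassCurve

variable (W : WeierstrassCurve ℚ) [W.IsElliptic]

/-- **The character sum along a fibre.** For `δ ≠ 0` dividing `Q = 2 N_W` and `Y ≥ 0`:
`∑_{m ≤ Y squarefree, (m, Q) = 1} w(W^{δ χ₄(m) m}) = w(W^δ) ∑_{m ≤ Y squarefree} χ₄(m) J(N_{W^δ} Q² | m)`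
(the factor `J(Q | m)²` is `1` for `(m, Q) = 1` and `0` otherwise). [folklore] -/
theorem sum_rootNumber_fibre_eq (hmod : exists_isNewformOf) {δ : ℤ} (hδ0 : δ ≠ 0)
    (hδQ : δ ∣ ((2 * W.conductorNorm ℤ : ℕ) : ℤ)) (Y : ℕ) :
    ∑ m ∈ (Icc 1 Y).filter (fun m : ℕ ↦ Squarefree m ∧ m.Coprime (2 * W.conductorNorm ℤ)),
        (W.quadraticTwist ((δ * χ₄ (m : ZMod 4) * m : ℤ) : ℚ)).rootNumber =
      (W.quadraticTwist (δ : ℚ)).rootNumber *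
        ∑ m ∈ (Icc 1 Y).filter (fun m : ℕ ↦ Squarefree m), χ₄ (m : ZMod 4) *
          J((((W.quadraticTwist (δ : ℚ)).conductorNorm ℤ * (2 * W.conductorNorm ℤ) ^ 2 : ℕ) : ℤ) | m) := by
  set Q : ℕ := 2 * W.conductorNorm ℤ with hQ
  set Nδ : ℕ := (W.quadraticTwist (δ : ℚ)).conductorNorm ℤ with hNδ
  set c : ℤ := (W.quadraticTwist (δ : ℚ)).rootNumber with hc
  have hQ0 : 0 < Q := by
    have := WeierstrassCurve.conductorNorm_pos_holds W
    rw [hQ]; omega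
  rw [mul_sum]
  symm
  rw [← sum_filter_of_ne (p := fun m : ℕ ↦ m.Coprime Q) ?_]
  · rw [filter_filter]
    refine sum_congr rfl fun m hm ↦ ?_
    simp only [mem_filter, mem_Icc] at hm
    obtain ⟨⟨hm1, -⟩, hsq, hcop⟩ := hm
    rw [rootNumber_quadraticTwist_mul_χ₄_mul W hmod hδ0 hδQ hsq hcop]
    have hJ : J(((Nδ * Q ^ 2 : ℕ) : ℤ) | m) = J((Nδ : ℤ) | m) := by
      have hg : ((Q : ℕ) : ℤ).gcd m = 1 := by
        rw [Int.gcd_natCast_natCast]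
        exact Nat.coprime_comm.mp hcop
      rw [Nat.cast_mul, jacobiSym.mul_left, Nat.cast_pow, jacobiSym.sq_one' hg, mul_one]
    rw [hJ]
    ring
  · intro m hm hne
    simp only [mem_filter, mem_Icc] at hm
    obtain ⟨⟨hm1, -⟩, -⟩ := hm
    by_contra hcop
    apply hne
    haveI : NeZero m := ⟨by omega⟩
    have hJ : J(((Nδ * Q ^ 2 : ℕ) : ℤ) | m) = 0 := by
      rw [jacobiSym.eq_zero_iff_not_coprime, Int.gcd_natCast_natCast]
      intro h1
      obtain ⟨p, hp, hpg⟩ := Nat.exists_prime_and_dvd hcop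
      have hpm : p ∣ m := hpg.trans (Nat.gcd_dvd_left m Q)
      have hpQ : p ∣ Q := hpg.trans (Nat.gcd_dvd_right m Q)
      have hp1 : p ∣ Nat.gcd (Nδ * Q ^ 2) m :=
        Nat.dvd_gcd (hpQ.trans (dvd_mul_of_dvd_right (dvd_pow_self Q two_ne_zero) Nδ)) hpm
      rw [h1] at hp1
      exact hp.ne_one (Nat.dvd_one.mp hp1)
    rw [hJ, mul_zero, mul_zero]

/-- `2 #{m ∈ s : w m = 1} − #s = ∑_{m ∈ s} w m` for a `±1`-valued `w`. [folklore] -/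
theorem two_mul_card_filter_sub_card_eq_sum {s : Finset ℕ} (w : ℕ → ℤ)
    (hw : ∀ m ∈ s, w m = 1 ∨ w m = -1) :
    2 * (((s.filter fun m ↦ w m = 1).card : ℕ) : ℤ) - s.card = ∑ m ∈ s, w m := by
  rw [card_filter, card_eq_sum_ones s]
  push_cast
  rw [mul_sum, ← sum_sub_distrib]
  refine sum_congr rfl fun m hm ↦ ?_
  rcases hw m hm with h | h <;> simp [h]

/-- **The main estimate.** For an elliptic `W / ℚ` there is a constant `C = C_W` with
`|2 #{d squarefree, |d| ≤ X : w(W^d) = +1} − #{d squarefree, |d| ≤ X}| ≤ C √X` for all `X`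
(from the Modularity Theorem). Explicitly `C = ∑_δ 4 N_{W^δ} Q²` over the squarefree divisors `δ`
of `Q = 2 N_W`. [folklore] -/
theorem abs_two_mul_card_rootNumber_sub_card_le (hmod : exists_isNewformOf) :
    ∃ C : ℝ, ∀ X : ℕ,
      |2 * (((Icc (-(X : ℤ)) X).filter fun d : ℤ ↦ Squarefree d ∧
          (d ≠ 0 ∧ (W.quadraticTwist (d : ℚ)).rootNumber = 1)).card : ℝ) -
        ((Icc (-(X : ℤ)) X).filter fun d : ℤ ↦ Squarefree d).card| ≤ C * Real.sqrt X := by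
  set Q : ℕ := 2 * W.conductorNorm ℤ with hQ
  have hQ0 : 0 < Q := by
    have := WeierstrassCurve.conductorNorm_pos_holds W
    rw [hQ]; omega
  have hQ2 : 2 ∣ Q := dvd_mul_right 2 _
  set T : Finset ℤ := (Icc (-(Q : ℤ)) Q).filter (fun δ ↦ Squarefree δ ∧ δ ∣ (Q : ℤ)) with hT
  -- the constant
  refine ⟨∑ δ ∈ T, (4 * ((W.quadraticTwist (δ : ℚ)).conductorNorm ℤ * Q ^ 2 : ℕ) : ℝ), fun X ↦ ?_⟩
  -- decompose both counts along `d = δ χ₄(m) m`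
  have hA := card_filter_squarefree_eq_sum_card hQ0 hQ2
    (fun d : ℤ ↦ d ≠ 0 ∧ (W.quadraticTwist (d : ℚ)).rootNumber = 1) X
  have hB := card_filter_squarefree_eq_sum_card' hQ0 hQ2 X
  -- fibrewise identity
  have hfib : ∀ δ ∈ T,
      (2 * ((((Icc 1 (X / δ.natAbs)).filter fun m : ℕ ↦
          Squarefree m ∧ m.Coprime Q ∧ (δ * χ₄ (m : ZMod 4) * m ≠ 0 ∧
            (W.quadraticTwist ((δ * χ₄ (m : ZMod 4) * m : ℤ) : ℚ)).rootNumber = 1)).card : ℕ) : ℤ) -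
        (((Icc 1 (X / δ.natAbs)).filter fun m : ℕ ↦ Squarefree m ∧ m.Coprime Q).card : ℕ)) =
      (W.quadraticTwist (δ : ℚ)).rootNumber *
        ∑ m ∈ (Icc 1 (X / δ.natAbs)).filter (fun m : ℕ ↦ Squarefree m), χ₄ (m : ZMod 4) *
          J((((W.quadraticTwist (δ : ℚ)).conductorNorm ℤ * Q ^ 2 : ℕ) : ℤ) | m) := by
    intro δ hδ
    simp only [hT, mem_filter] at hδ
    obtain ⟨-, hδsq, hδQ⟩ := hδ
    have hδ0 : δ ≠ 0 := hδsq.ne_zero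
    have hset : ((Icc 1 (X / δ.natAbs)).filter fun m : ℕ ↦
          Squarefree m ∧ m.Coprime Q ∧ (δ * χ₄ (m : ZMod 4) * m ≠ 0 ∧
            (W.quadraticTwist ((δ * χ₄ (m : ZMod 4) * m : ℤ) : ℚ)).rootNumber = 1)) =
        (((Icc 1 (X / δ.natAbs)).filter fun m : ℕ ↦ Squarefree m ∧ m.Coprime Q).filter
          fun m : ℕ ↦ (W.quadraticTwist ((δ * χ₄ (m : ZMod 4) * m : ℤ) : ℚ)).rootNumber = 1) := by
      ext m
      simp only [mem_filter, mem_Icc]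
      constructor
      · rintro ⟨hm, hsq, hcop, -, hw⟩; exact ⟨⟨hm, hsq, hcop⟩, hw⟩
      · rintro ⟨⟨hm, hsq, hcop⟩, hw⟩
        refine ⟨hm, hsq, hcop, ?_, hw⟩
        have hmodd : Odd m := odd_of_coprime_of_two_dvd hQ2 hcop
        intro h0
        have := congrArg Int.natAbs h0
        rw [natAbs_mul_χ₄_mul hmodd, Int.natAbs_zero, mul_eq_zero] at this
        rcases this with h | h
        · exact hδ0 (Int.natAbs_eq_zero.mp h)
        · omega
    rw [← sum_rootNumber_fibre_eq W hmod hδ0 hδQ, hset]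
    exact two_mul_card_filter_sub_card_eq_sum _ (fun m _ ↦ WeierstrassCurve.rootNumber_eq_one_or _)
  -- sum the fibrewise identities
  have hmain : (2 * ((((Icc (-(X : ℤ)) X).filter fun d : ℤ ↦ Squarefree d ∧
      (d ≠ 0 ∧ (W.quadraticTwist (d : ℚ)).rootNumber = 1)).card : ℕ) : ℤ) -
      (((Icc (-(X : ℤ)) X).filter fun d : ℤ ↦ Squarefree d).card : ℕ)) =
      ∑ δ ∈ T, (W.quadraticTwist (δ : ℚ)).rootNumber *
        ∑ m ∈ (Icc 1 (X / δ.natAbs)).filter (fun m : ℕ ↦ Squarefree m), χ₄ (m : ZMod 4) *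
          J((((W.quadraticTwist (δ : ℚ)).conductorNorm ℤ * Q ^ 2 : ℕ) : ℤ) | m) := by
    rw [hA, hB]
    push_cast
    rw [mul_sum, ← sum_sub_distrib]
    refine sum_congr rfl fun δ hδ ↦ ?_
    have := hfib δ hδ
    push_cast at this
    exact this
  -- estimate
  have hmainR : (2 * ((((Icc (-(X : ℤ)) X).filter fun d : ℤ ↦ Squarefree d ∧
      (d ≠ 0 ∧ (W.quadraticTwist (d : ℚ)).rootNumber = 1)).card : ℕ) : ℝ) -
      (((Icc (-(X : ℤ)) X).filter fun d : ℤ ↦ Squarefree d).card : ℕ)) =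
      ((∑ δ ∈ T, (W.quadraticTwist (δ : ℚ)).rootNumber *
        ∑ m ∈ (Icc 1 (X / δ.natAbs)).filter (fun m : ℕ ↦ Squarefree m), χ₄ (m : ZMod 4) *
          J((((W.quadraticTwist (δ : ℚ)).conductorNorm ℤ * Q ^ 2 : ℕ) : ℤ) | m) : ℤ) : ℝ) := by
    exact_mod_cast hmain
  rw [hmainR, Int.cast_sum, sum_mul]
  refine (abs_sum_le_sum_abs _ _).trans (sum_le_sum fun δ hδ ↦ ?_)
  have ha : 0 < (W.quadraticTwist (δ : ℚ)).conductorNorm ℤ * Q ^ 2 := by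
    have hδ0 : (δ : ℚ) ≠ 0 := by
      simp only [hT, mem_filter] at hδ
      exact_mod_cast hδ.2.1.ne_zero
    haveI := W.isElliptic_quadraticTwist hδ0
    exact Nat.mul_pos (WeierstrassCurve.conductorNorm_pos_holds _) (pow_pos hQ0 2)
  have h1 := abs_sum_squarefree_χ₄_mul_jacobiSym_le ha (X / δ.natAbs)
  have hw : |((W.quadraticTwist (δ : ℚ)).rootNumber : ℤ)| = 1 := by
    rcases WeierstrassCurve.rootNumber_eq_one_or (W.quadraticTwist (δ : ℚ)) with h | h <;> rw [h] <;> simp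
  have h2 : |(((W.quadraticTwist (δ : ℚ)).rootNumber *
      ∑ m ∈ (Icc 1 (X / δ.natAbs)).filter (fun m : ℕ ↦ Squarefree m), χ₄ (m : ZMod 4) *
        J((((W.quadraticTwist (δ : ℚ)).conductorNorm ℤ * Q ^ 2 : ℕ) : ℤ) | m) : ℤ) : ℝ)| ≤
      ((4 * ((W.quadraticTwist (δ : ℚ)).conductorNorm ℤ * Q ^ 2 : ℕ) * Nat.sqrt (X / δ.natAbs) : ℤ) : ℝ) := by
    rw [← Int.cast_abs]
    exact_mod_cast (show |((W.quadraticTwist (δ : ℚ)).rootNumber *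
      ∑ m ∈ (Icc 1 (X / δ.natAbs)).filter (fun m : ℕ ↦ Squarefree m), χ₄ (m : ZMod 4) *
        J((((W.quadraticTwist (δ : ℚ)).conductorNorm ℤ * Q ^ 2 : ℕ) : ℤ) | m) : ℤ)| ≤
      4 * ((W.quadraticTwist (δ : ℚ)).conductorNorm ℤ * Q ^ 2 : ℕ) * Nat.sqrt (X / δ.natAbs) by
        rw [abs_mul, hw, one_mul]; exact h1)
  refine h2.trans ?_
  have hsqrt : ((Nat.sqrt (X / δ.natAbs) : ℕ) : ℝ) ≤ Real.sqrt X := by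
    have h3 : Nat.sqrt (X / δ.natAbs) ≤ Nat.sqrt X := Nat.sqrt_le_sqrt (Nat.div_le_self _ _)
    calc ((Nat.sqrt (X / δ.natAbs) : ℕ) : ℝ) ≤ (Nat.sqrt X : ℕ) := by exact_mod_cast h3
      _ = Real.sqrt (((Nat.sqrt X : ℕ) : ℝ) ^ 2) := (Real.sqrt_sq (Nat.cast_nonneg _)).symm
      _ ≤ Real.sqrt X := Real.sqrt_le_sqrt (by exact_mod_cast Nat.sqrt_le' X)
  push_cast
  exact mul_le_mul_of_nonneg_left hsqrt (by positivity)

end Assembly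

/-! ### The density `1/2` -/

section Density

open Literature.NumberTheory.EllipticCurves.ModularForms WeierstrassCurve

/-- **A square-root error term gives density `1/2`.** If
`|2 #{d squarefree, |d| ≤ X, P d} − #{d squarefree, |d| ≤ X}| ≤ C √X` for all `X`, then
`twistDensity P (1/2)` (the denominator is `≥ X/4`). [folklore] -/
theorem twistDensity_half_of_abs_le {P : ℤ → Prop} {C : ℝ}
    (h : ∀ X : ℕ, |2 * (((Icc (-(X : ℤ)) X).filter fun d : ℤ ↦ Squarefree d ∧ P d).card : ℝ) -
      ((Icc (-(X : ℤ)) X).filter fun d : ℤ ↦ Squarefree d).card| ≤ C * Real.sqrt X) :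
    twistDensity P (1 / 2) := by
  unfold twistDensity
  have hC : 0 ≤ C := by
    have h1 := h 1
    have hs : Real.sqrt (1 : ℕ) = 1 := by simp
    rw [hs, mul_one] at h1
    exact (abs_nonneg _).trans h1
  -- the error bound `2C/√X → 0`
  have h0 : Tendsto (fun X : ℕ ↦ 2 * C / Real.sqrt X) atTop (𝓝 0) :=
    tendsto_const_nhds.div_atTop (Real.tendsto_sqrt_atTop.comp tendsto_natCast_atTop_atTop)
  have hlo : Tendsto (fun X : ℕ ↦ 1 / 2 - 2 * C / Real.sqrt X) atTop (𝓝 (1 / 2)) := by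
    simpa using tendsto_const_nhds.sub h0
  have hhi : Tendsto (fun X : ℕ ↦ 1 / 2 + 2 * C / Real.sqrt X) atTop (𝓝 (1 / 2)) := by
    simpa using tendsto_const_nhds.add h0
  -- the deviation bound for `X ≥ 1`
  have hdev : ∀ X : ℕ, 1 ≤ X →
      |(Nat.card {d : ℤ | Squarefree d ∧ |d| ≤ (X : ℤ) ∧ P d} : ℝ) /
          Nat.card {d : ℤ | Squarefree d ∧ |d| ≤ (X : ℤ)} - 1 / 2| ≤ 2 * C / Real.sqrt X := by
    intro X hX
    rw [natCard_setOf_squarefree_eq P X, natCard_setOf_squarefree_eq' X]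
    set A : ℝ := (((Icc (-(X : ℤ)) X).filter fun d : ℤ ↦ Squarefree d).card : ℝ) with hA
    set B : ℝ := (((Icc (-(X : ℤ)) X).filter fun d : ℤ ↦ Squarefree d ∧ P d).card : ℝ) with hB
    have hApos : (X : ℝ) / 4 ≤ A := sqfreeCount_true_ge X
    have hX1 : (1 : ℝ) ≤ X := by exact_mod_cast hX
    have hA0 : 0 < A := by linarith
    have hsqrt0 : 0 < Real.sqrt X := Real.sqrt_pos.mpr (by linarith)
    have heq : B / A - 1 / 2 = (2 * B - A) / (2 * A) := by
      field_simp
    rw [heq, abs_div, abs_of_pos (by linarith : (0 : ℝ) < 2 * A)]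
    have hXs : (X : ℝ) = Real.sqrt X * Real.sqrt X := (Real.mul_self_sqrt (by linarith)).symm
    rw [div_le_div_iff₀ (by linarith) hsqrt0]
    calc |2 * B - A| * Real.sqrt X ≤ C * Real.sqrt X * Real.sqrt X :=
          mul_le_mul_of_nonneg_right (h X) hsqrt0.le
      _ = C * X := by rw [mul_assoc, ← hXs]
      _ ≤ C * (4 * A) := mul_le_mul_of_nonneg_left (by linarith) hC
      _ = 2 * C * (2 * A) := by ring
  refine tendsto_of_tendsto_of_tendsto_of_le_of_le' hlo hhi ?_ ?_
  · filter_upwards [eventually_ge_atTop 1] with X hX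
    have := hdev X hX
    rw [abs_le] at this
    linarith [this.1]
  · filter_upwards [eventually_ge_atTop 1] with X hX
    have := hdev X hX
    rw [abs_le] at this
    linarith [this.2]

variable (W : WeierstrassCurve ℚ) [W.IsElliptic]

/-- **Equidistribution of the root number in the quadratic twist family** (the classical input to
Goldfeld's conjecture; Murty–Murty 1997, Ch. 6 §1 for the sign of the twisted functional equation):
for an elliptic `W / ℚ`, among the squarefree `d` ordered by `|d|` the twists `W^d` with global root
number `w(W^d) = +1` have density `1/2` — from the Modularity Theorem `exists_isNewformOf` alone.
[cite: MurtyMurty1997, Ch. 6 §1] -/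
theorem twistDensity_rootNumber_quadraticTwist_eq_one (hmod : exists_isNewformOf) :
    twistDensity (fun d ↦ d ≠ 0 ∧ (W.quadraticTwist d).rootNumber = 1) (1 / 2) := by
  obtain ⟨C, hC⟩ := abs_two_mul_card_rootNumber_sub_card_le W hmod
  refine twistDensity_half_of_abs_le (C := C) fun X ↦ ?_
  convert hC X

/-- The complementary density: `w(W^d) = −1` for `50 %` of the squarefree `d`. [cite: MurtyMurty1997, Ch. 6 §1] -/
theorem twistDensity_rootNumber_quadraticTwist_eq_neg_one (hmod : exists_isNewformOf) :
    twistDensity (fun d ↦ d ≠ 0 ∧ (W.quadraticTwist d).rootNumber = -1) (1 / 2) := by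
  have h := (twistDensity_rootNumber_quadraticTwist_eq_one W hmod).compl
  rw [sub_half] at h
  refine (twistDensity_congr (fun d hd ↦ ?_) _).mp h
  have hd0 : d ≠ 0 := hd.ne_zero
  rcases WeierstrassCurve.rootNumber_eq_one_or (W.quadraticTwist (d : ℚ)) with h1 | h1
  · simp [h1, hd0]
  · simp [h1, hd0]

/-- **Root-number equidistribution in Smith's printed normalisation**: for `ε = ±1`,
`#{d ∈ ℤ : 0 < |d| ≤ H, w(W^d) = ε} / 2H → 1/2` as `H → ∞` (all nonzero `d`, as in
arXiv:2503.17619, Thm. 1.1; the bridge is `twistDensity_rootNumber_iff_printed`).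
[cite: MurtyMurty1997, Ch. 6 §1] [cite: arXiv250317619, Thm. 1.1 (normalisation)] -/
theorem tendsto_card_rootNumber_quadraticTwist_eq (hmod : exists_isNewformOf) {ε : ℤ}
    (hε : ε = 1 ∨ ε = -1) :
    Tendsto (fun H : ℕ ↦ (Nat.card {d : ℤ | d ≠ 0 ∧ |d| ≤ (H : ℤ) ∧
      (W.quadraticTwist d).rootNumber = ε} : ℝ) / (2 * H)) atTop (𝓝 (1 / 2)) := by
  rw [← twistDensity_rootNumber_iff_printed]
  rcases hε with rfl | rfl
  · exact twistDensity_rootNumber_quadraticTwist_eq_one W hmod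
  · exact twistDensity_rootNumber_quadraticTwist_eq_neg_one W hmod

/-! ### Smith's Thm. 1.1 reduced to its core statement -/

/-- **bsd.S34 ⇔ "`r_{2^∞}(E^d) ≤ 1` for `100 %` of `d`", granted `2`-parity and Modularity.** For an
elliptic `W / ℚ`, if `2`-parity holds for every elliptic curve over `ℚ` (`hpar`, bsd.S19 at `p = 2`:
Monsky 1996, Dokchitser–Dokchitser 2010) and the Modularity Theorem holds (`hmod`), then
`smith_selmerCorank_density W` (A. Smith, arXiv:2503.17619, Thm. 1.1: `2^∞`-Selmer corank `0`, `1`,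
`≥ 2` for `50 %`, `50 %`, `0 %` of the quadratic twists) is equivalent to the single statement that
the squarefree `d` with `r_{2^∞}(W^d) ≤ 1` have density `1`: the parity split is supplied by
`twistDensity_rootNumber_quadraticTwist_eq_one`.
[cite: arXiv250317619, Thm. 1.1 and display (1.2)] [cite: MurtyMurty1997, Ch. 6 §1] -/
theorem smith_selmerCorank_density_iff_le_one
    (hpar : ∀ (E : WeierstrassCurve ℚ) [E.IsElliptic], p_parity E 2) (hmod : exists_isNewformOf) :
    smith_selmerCorank_density W ↔
      twistDensity (fun d ↦ d ≠ 0 ∧ selmerCorankTwoInfty (W.quadraticTwist d) ≤ 1) 1 := by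
  rw [smith_selmerCorank_density_iff_le_one_and_rootNumber W hpar]
  exact ⟨fun h ↦ h.1, fun h ↦ ⟨h, twistDensity_rootNumber_quadraticTwist_eq_one W hmod⟩⟩

/-- **bsd.S34 ⇔ its core statement, with `2`-parity taken from its sources in the tree**: as
`smith_selmerCorank_density_iff_le_one`, with `hpar` replaced by Monsky's congruence
`corank_{ℤ_2} Sel_{2^∞}(E'/ℚ) ≡ ord_{s=1} L(E', s) (mod 2)` (`hMon : monsky_selmerCorank_two_mod_two_eq`;
Dokchitser–Dokchitser 2010, §4.6) and the Modularity Theorem (`hmod`), via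
`p_parity_of_selmerCorank_mod_two_eq_of_exists_isNewformOf`. Thus, from the named facts of the tree,
**Smith's Thm. 1.1 is exactly the statement "`r_{2^∞}(E^d) ≤ 1` for `100 %` of the squarefree `d`"**.
[cite: arXiv250317619, Thm. 1.1 and display (1.2)] [cite: DokchitserDokchitserAnnals2010, §4.6, proof of Thm. 4.19 (case p = 2)] -/
theorem smith_selmerCorank_density_iff_le_one_of_exists_isNewformOf (hmod : exists_isNewformOf)
    (hMon : monsky_selmerCorank_two_mod_two_eq) :
    smith_selmerCorank_density W ↔
      twistDensity (fun d ↦ d ≠ 0 ∧ selmerCorankTwoInfty (W.quadraticTwist d) ≤ 1) 1 :=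
  smith_selmerCorank_density_iff_le_one W
    (fun E _ ↦ p_parity_of_selmerCorank_mod_two_eq_of_exists_isNewformOf E 2 hmod (hMon.apply E)) hmod

/-- **Sufficiency**: Modularity, Monsky's `2`-parity congruence and "`r_{2^∞}(E^d) ≤ 1` for `100 %`
of the squarefree `d`" give `smith_selmerCorank_density W`.
[cite: arXiv250317619, Thm. 1.1 and display (1.2)] -/
theorem smith_selmerCorank_density_of_le_one (hmod : exists_isNewformOf)
    (hMon : monsky_selmerCorank_two_mod_two_eq)
    (h₁ : twistDensity (fun d ↦ d ≠ 0 ∧ selmerCorankTwoInfty (W.quadraticTwist d) ≤ 1) 1) :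
    smith_selmerCorank_density W :=
  (smith_selmerCorank_density_iff_le_one_of_exists_isNewformOf W hmod hMon).mpr h₁

/-- **Parity is equidistributed in the quadratic twist family** (unconditionally in Thm. 1.1):
granted `2`-parity (`hpar`) and Modularity, the squarefree `d` with `r_{2^∞}(W^d)` even have density
`1/2`. [cite: arXiv250317619, §1 display (1.2)] [cite: MurtyMurty1997, Ch. 6 §1] -/
theorem twistDensity_even_selmerCorankTwoInfty
    (hpar : ∀ (E : WeierstrassCurve ℚ) [E.IsElliptic], p_parity E 2) (hmod : exists_isNewformOf) :
    twistDensity (fun d ↦ d ≠ 0 ∧ Even (selmerCorankTwoInfty (W.quadraticTwist d))) (1 / 2) :=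
  (twistDensity_even_selmerCorankTwoInfty_iff_rootNumber W hpar _).mpr
    (twistDensity_rootNumber_quadraticTwist_eq_one W hmod)

/-- The same with `2`-parity taken from Monsky's congruence and Modularity.
[cite: arXiv250317619, §1 display (1.2)] [cite: DokchitserDokchitserAnnals2010, §4.6, proof of Thm. 4.19 (case p = 2)] -/
theorem twistDensity_even_selmerCorankTwoInfty_of_exists_isNewformOf (hmod : exists_isNewformOf)
    (hMon : monsky_selmerCorank_two_mod_two_eq) :
    twistDensity (fun d ↦ d ≠ 0 ∧ Even (selmerCorankTwoInfty (W.quadraticTwist d))) (1 / 2) :=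
  twistDensity_even_selmerCorankTwoInfty W
    (fun E _ ↦ p_parity_of_selmerCorank_mod_two_eq_of_exists_isNewformOf E 2 hmod (hMon.apply E)) hmod

/-- **bsd.S34 ⇔ "`r_{2^∞}(E^d) ≥ 2` for `0 %` of `d`"**, granted Modularity and Monsky's `2`-parity
congruence: the complement form of `smith_selmerCorank_density_iff_le_one_of_exists_isNewformOf` — the
whole content of Smith's Thm. 1.1 beyond parity is that the twists of `2^∞`-Selmer corank at least `2`
are sparse. [cite: arXiv250317619, Thm. 1.1 and display (1.2)] -/
theorem smith_selmerCorank_density_iff_two_le_of_exists_isNewformOf (hmod : exists_isNewformOf)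
    (hMon : monsky_selmerCorank_two_mod_two_eq) :
    smith_selmerCorank_density W ↔
      twistDensity (fun d ↦ d ≠ 0 ∧ 2 ≤ selmerCorankTwoInfty (W.quadraticTwist d)) 0 := by
  rw [smith_selmerCorank_density_iff_le_one_of_exists_isNewformOf W hmod hMon]
  constructor
  · intro h
    have h' := h.compl
    rw [sub_self] at h'
    refine (twistDensity_congr (fun d hd ↦ ?_) 0).mp h'
    have hd0 : d ≠ 0 := hd.ne_zero
    simp only [not_and, not_le]
    exact ⟨fun h1 ↦ ⟨hd0, h1 hd0⟩, fun h1 _ ↦ h1.2⟩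
  · intro h
    have h' := h.compl
    rw [sub_zero] at h'
    refine (twistDensity_congr (fun d hd ↦ ?_) 1).mp h'
    have hd0 : d ≠ 0 := hd.ne_zero
    simp only [not_and, not_le]
    exact ⟨fun h1 ↦ ⟨hd0, Nat.le_of_lt_succ (h1 hd0)⟩, fun h1 _ ↦ Nat.lt_succ_of_le h1.2⟩

end Density

/-! ### Thm. 1.1 does not depend on the Weierstrass model -/

section Model

open WeierstrassCurve

variable (W : WeierstrassCurve ℚ)

/-- **The `2^∞`-Selmer corank of the twist does not depend on the model**: for an admissible change
of variables `C = (u, r, s, t)`, `(C • W)^d = (u, d r, 0, 0) • W^d` (`quadraticTwist_smul`), and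
`ℚ`-isomorphic curves have isomorphic `2^∞`-Selmer groups (`selmerCorank_eq_of_variableChange`;
Silverman, *AEC*, X.§4). [cite: SilvermanAEC2009, X.§4] -/
theorem selmerCorankTwoInfty_quadraticTwist_smul (C : VariableChange ℚ) (d : ℚ) :
    selmerCorankTwoInfty ((C • W).quadraticTwist d) = selmerCorankTwoInfty (W.quadraticTwist d) := by
  rw [quadraticTwist_smul, selmerCorankTwoInfty_eq, selmerCorankTwoInfty_eq]
  exact (selmerCorank_eq_of_variableChange 2 rfl).symm

/-- **Smith's Thm. 1.1 is a statement about the elliptic curve `E / ℚ`, not about the chosen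
Weierstrass model**: `smith_selmerCorank_density (C • W) ↔ smith_selmerCorank_density W` for every
admissible change of variables `C` (the source's `E` is an abstract elliptic curve over `ℚ` and `E^d`
its twist by `ℚ(√d)`; the tree's `W.quadraticTwist d` is a model of it, and models of isomorphic
curves give isomorphic twists). [cite: arXiv250317619, Thm. 1.1] [cite: SilvermanAEC2009, X.5 Cor. 5.4] -/
theorem smith_selmerCorank_density_smul_iff (C : VariableChange ℚ) :
    smith_selmerCorank_density (C • W) ↔ smith_selmerCorank_density W := by
  unfold smith_selmerCorank_density
  simp only [selmerCorankTwoInfty_quadraticTwist_smul]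

end Model

/-! ### Cor. 1.3: the tree's form is equivalent to the printed conditional densities -/

section Cor13

open Literature.NumberTheory.EllipticCurves.ModularForms WeierstrassCurve

variable {P R : ℤ → Prop} {δ : ℝ}

/-- **Subtracting densities**: if `P` and `P ∧ R` both have density `δ` among the squarefree `d`,
then `P ∧ ¬R` has density `0`. [folklore] -/
theorem twistDensity.and_not_of_and (hP : twistDensity P δ)
    (hPR : twistDensity (fun d ↦ P d ∧ R d) δ) : twistDensity (fun d ↦ P d ∧ ¬ R d) 0 := by
  unfold twistDensity at hP hPR ⊢
  have h := hP.sub hPR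
  rw [sub_self] at h
  refine h.congr' (Eventually.of_forall fun X ↦ ?_)
  have hU : {d : ℤ | Squarefree d ∧ |d| ≤ (X : ℤ) ∧ P d} =
      {d : ℤ | Squarefree d ∧ |d| ≤ (X : ℤ) ∧ (P d ∧ R d)} ∪
        {d : ℤ | Squarefree d ∧ |d| ≤ (X : ℤ) ∧ (P d ∧ ¬ R d)} := by
    ext d
    simp only [Set.mem_setOf_eq, Set.mem_union]
    tauto
  have hdisj : Disjoint {d : ℤ | Squarefree d ∧ |d| ≤ (X : ℤ) ∧ (P d ∧ R d)}
      {d : ℤ | Squarefree d ∧ |d| ≤ (X : ℤ) ∧ (P d ∧ ¬ R d)} :=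
    Set.disjoint_left.mpr fun d h1 h2 ↦ h2.2.2.2 h1.2.2.2
  have hc : (Nat.card {d : ℤ | Squarefree d ∧ |d| ≤ (X : ℤ) ∧ P d} : ℝ) =
      Nat.card {d : ℤ | Squarefree d ∧ |d| ≤ (X : ℤ) ∧ (P d ∧ R d)} +
        Nat.card {d : ℤ | Squarefree d ∧ |d| ≤ (X : ℤ) ∧ (P d ∧ ¬ R d)} := by
    have := Set.ncard_union_eq hdisj (finite_setOf_squarefree_abs_le X _)
      (finite_setOf_squarefree_abs_le X _)
    rw [← hU] at this
    simp only [Nat.card_coe_set_eq]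
    exact_mod_cast this
  dsimp only
  rw [hc]
  ring

variable (W : WeierstrassCurve ℚ) [W.IsElliptic]

/-- **One root-number class of Cor. 1.3.** Granted that the twists with `w(W^d) = ε` have density
`1/2` among the squarefree `d` (Modularity, `twistDensity_rootNumber_quadraticTwist_eq_one/neg_one`),
the tree's reading "density `1` of `d ≠ 0 → w(W^d) = ε → ρ(rank W^d(ℚ))`" is EQUIVALENT to the
printed conditional density "`#{0 < |d| ≤ H : w(W^d) = ε, ρ(rank)} / #{0 < |d| ≤ H : w(W^d) = ε} → 1`"
(all nonzero `d`, as in arXiv:2503.17619): intersect with / subtract the density-`1/2` class, and pass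
between the two normalisations by the isomorphism invariance of `w` and of the rank under `d ↦ d e²`
(`twistDensity_iff_printed_of_invariant`). [cite: arXiv250317619, Cor. 1.3] -/
theorem twistDensity_rootNumber_imp_iff_printed (ε : ℤ) (ρ : ℕ → Prop)
    (hw : twistDensity (fun d ↦ d ≠ 0 ∧ (W.quadraticTwist d).rootNumber = ε) (1 / 2)) :
    twistDensity (fun d ↦ d ≠ 0 → (W.quadraticTwist d).rootNumber = ε →
        ρ (W.quadraticTwist d).mordellWeilRank) 1 ↔
      Tendsto (fun H : ℕ ↦ (Nat.card {d : ℤ | d ≠ 0 ∧ |d| ≤ (H : ℤ) ∧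
        ((W.quadraticTwist d).rootNumber = ε ∧ ρ (W.quadraticTwist d).mordellWeilRank)} : ℝ) /
          Nat.card {d : ℤ | d ≠ 0 ∧ |d| ≤ (H : ℤ) ∧ (W.quadraticTwist d).rootNumber = ε})
        atTop (𝓝 1) := by
  have hwP := (twistDensity_rootNumber_iff_printed W ε _).1 hw
  have hinv : ∀ d e : ℚ, d ≠ 0 → e ≠ 0 →
      ((fun E : WeierstrassCurve ℚ ↦ E.rootNumber = ε ∧ ρ E.mordellWeilRank)
          (W.quadraticTwist (d * e ^ 2)) ↔
        (fun E : WeierstrassCurve ℚ ↦ E.rootNumber = ε ∧ ρ E.mordellWeilRank) (W.quadraticTwist d)) :=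
    fun d e hd he ↦ by
      simp only [rootNumber_quadraticTwist_mul_sq W hd e he, mordellWeilRank_quadraticTwist_mul_sq W d e he]
  have hbridge := twistDensity_iff_printed_of_invariant W
    (p := fun E : WeierstrassCurve ℚ ↦ E.rootNumber = ε ∧ ρ E.mordellWeilRank) hinv (1 / 2)
  constructor
  · intro hC
    have hA : twistDensity (fun d ↦ d ≠ 0 ∧ ((W.quadraticTwist d).rootNumber = ε ∧
        ρ (W.quadraticTwist d).mordellWeilRank)) (1 / 2) := by
      refine (twistDensity_congr (fun d _ ↦ ?_) _).1 (hw.and_one hC)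
      tauto
    exact tendsto_card_div_card_of_tendsto (by norm_num) (hbridge.1 hA) hwP
  · intro hratio
    have hpos : ∀ᶠ H : ℕ in atTop, (1 / 4 : ℝ) <
        (Nat.card {d : ℤ | d ≠ 0 ∧ |d| ≤ (H : ℤ) ∧ (W.quadraticTwist d).rootNumber = ε} : ℝ) / (2 * H) :=
      (tendsto_order.1 hwP).1 _ (by norm_num)
    have hnum : Tendsto (fun H : ℕ ↦ (Nat.card {d : ℤ | d ≠ 0 ∧ |d| ≤ (H : ℤ) ∧
        ((W.quadraticTwist d).rootNumber = ε ∧ ρ (W.quadraticTwist d).mordellWeilRank)} : ℝ) /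
          (2 * H)) atTop (𝓝 (1 / 2)) := by
      have h := hratio.mul hwP
      rw [one_mul] at h
      refine h.congr' ?_
      filter_upwards [hpos] with H hH
      have hD : (Nat.card {d : ℤ | d ≠ 0 ∧ |d| ≤ (H : ℤ) ∧ (W.quadraticTwist d).rootNumber = ε} : ℝ) ≠ 0 := by
        intro h0
        rw [h0, zero_div] at hH
        norm_num at hH
      rw [div_mul_div_comm, mul_comm _ (Nat.card {d : ℤ | d ≠ 0 ∧ |d| ≤ (H : ℤ) ∧
        (W.quadraticTwist d).rootNumber = ε} : ℝ), mul_div_mul_left _ _ hD]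
    have hA := hbridge.2 hnum
    have hA' : twistDensity (fun d ↦ (d ≠ 0 ∧ (W.quadraticTwist d).rootNumber = ε) ∧
        ρ (W.quadraticTwist d).mordellWeilRank) (1 / 2) := by
      refine (twistDensity_congr (fun d _ ↦ ?_) _).1 hA
      tauto
    have h1 := (hw.and_not_of_and hA').compl
    rw [sub_zero] at h1
    refine (twistDensity_congr (fun d _ ↦ ?_) _).1 h1
    tauto

/-- **bsd.S34, Cor. 1.3: the tree's transcription is equivalent to the printed statement, granted
Modularity.** A. Smith, arXiv:2503.17619, Cor. 1.3: "Choose any elliptic curve `E/ℚ`. Then, among the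
quadratic twists `E^d` with `w(E^d) = +1`, `100 %` have rank `0`. Further, among the quadratic twists
with `w(E^d) = −1`, `100 %` have rank at most `1`." The tree's `smith_rank_of_rootNumber W`
(`BSDSelmer`: density `1`, among squarefree `d`, of the two implications
`d ≠ 0 → w(E^d) = ±1 → rank E^d(ℚ) = 0`, resp. `≤ 1`) is equivalent to the printed pair of
conditional densities (all `d ≠ 0` with `|d| ≤ H`), because each root-number class has density `1/2`
from the Modularity Theorem (`twistDensity_rootNumber_quadraticTwist_eq_one/neg_one`) — without that
input a density-`1` implication could be vacuous on a sparse class. [cite: arXiv250317619, Cor. 1.3]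
[cite: MurtyMurty1997, Ch. 6 §1] -/
theorem smith_rank_of_rootNumber_iff_printed (hmod : exists_isNewformOf) :
    smith_rank_of_rootNumber W ↔
      (Tendsto (fun H : ℕ ↦ (Nat.card {d : ℤ | d ≠ 0 ∧ |d| ≤ (H : ℤ) ∧
          ((W.quadraticTwist d).rootNumber = 1 ∧ (W.quadraticTwist d).mordellWeilRank = 0)} : ℝ) /
            Nat.card {d : ℤ | d ≠ 0 ∧ |d| ≤ (H : ℤ) ∧ (W.quadraticTwist d).rootNumber = 1})
          atTop (𝓝 1) ∧
        Tendsto (fun H : ℕ ↦ (Nat.card {d : ℤ | d ≠ 0 ∧ |d| ≤ (H : ℤ) ∧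
          ((W.quadraticTwist d).rootNumber = -1 ∧ (W.quadraticTwist d).mordellWeilRank ≤ 1)} : ℝ) /
            Nat.card {d : ℤ | d ≠ 0 ∧ |d| ≤ (H : ℤ) ∧ (W.quadraticTwist d).rootNumber = -1})
          atTop (𝓝 1)) := by
  unfold smith_rank_of_rootNumber
  exact and_congr
    (twistDensity_rootNumber_imp_iff_printed W 1 (fun r ↦ r = 0)
      (twistDensity_rootNumber_quadraticTwist_eq_one W hmod))
    (twistDensity_rootNumber_imp_iff_printed W (-1) (fun r ↦ r ≤ 1)
      (twistDensity_rootNumber_quadraticTwist_eq_neg_one W hmod))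

/-- **Cor. 1.3 as printed, from Thm. 1.1, Monsky's `2`-parity congruence and Modularity** (A. Smith,
arXiv:2503.17619, Cor. 1.3, deduced from Thm. 1.1 and (1.2)): the two printed conditional densities,
via the tree's `smith_rank_of_rootNumber_of_facts_of_exists_isNewformOf` (`BSDSelmerSmithProofs`) and
`smith_rank_of_rootNumber_iff_printed`. [cite: arXiv250317619, Cor. 1.3] -/
theorem smith_rank_of_rootNumber_printed_of_exists_isNewformOf (hmod : exists_isNewformOf)
    (hMon : monsky_selmerCorank_two_mod_two_eq) (hS : smith_selmerCorank_density W) :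
    Tendsto (fun H : ℕ ↦ (Nat.card {d : ℤ | d ≠ 0 ∧ |d| ≤ (H : ℤ) ∧
        ((W.quadraticTwist d).rootNumber = 1 ∧ (W.quadraticTwist d).mordellWeilRank = 0)} : ℝ) /
          Nat.card {d : ℤ | d ≠ 0 ∧ |d| ≤ (H : ℤ) ∧ (W.quadraticTwist d).rootNumber = 1})
        atTop (𝓝 1) ∧
      Tendsto (fun H : ℕ ↦ (Nat.card {d : ℤ | d ≠ 0 ∧ |d| ≤ (H : ℤ) ∧
        ((W.quadraticTwist d).rootNumber = -1 ∧ (W.quadraticTwist d).mordellWeilRank ≤ 1)} : ℝ) /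
          Nat.card {d : ℤ | d ≠ 0 ∧ |d| ≤ (H : ℤ) ∧ (W.quadraticTwist d).rootNumber = -1})
        atTop (𝓝 1) :=
  (smith_rank_of_rootNumber_iff_printed W hmod).1
    (smith_rank_of_rootNumber_of_facts_of_exists_isNewformOf W hmod hMon hS)

end Cor13

/-! ### The half of Thm. 1.1 that parity gives: one-sided bounds -/

section OneSided

open Literature.NumberTheory.EllipticCurves.ModularForms WeierstrassCurve

variable {P Q : ℤ → Prop} {δ : ℝ}

/-- **Upper bounds transfer along inclusions**: if `P d → Q d` for squarefree `d` and the `Q`-twists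
have density `δ`, then for every `ε > 0` the proportion of `P`-twists among the squarefree `|d| ≤ X`
is eventually `≤ δ + ε` (an upper-density statement; `P` need not have a density). [folklore] -/
theorem twistDensity.eventually_ratio_le (hQ : twistDensity Q δ)
    (hPQ : ∀ d, Squarefree d → P d → Q d) {ε : ℝ} (hε : 0 < ε) :
    ∀ᶠ X : ℕ in atTop, (Nat.card {d : ℤ | Squarefree d ∧ |d| ≤ (X : ℤ) ∧ P d} : ℝ) /
      Nat.card {d : ℤ | Squarefree d ∧ |d| ≤ (X : ℤ)} ≤ δ + ε := by
  have h1 : ∀ᶠ X : ℕ in atTop, (Nat.card {d : ℤ | Squarefree d ∧ |d| ≤ (X : ℤ) ∧ Q d} : ℝ) /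
      Nat.card {d : ℤ | Squarefree d ∧ |d| ≤ (X : ℤ)} < δ + ε :=
    (tendsto_order.1 hQ).2 _ (by linarith)
  filter_upwards [h1] with X hX
  refine le_trans (div_le_div_of_nonneg_right ?_ (Nat.cast_nonneg _)) hX.le
  have hsub : {d : ℤ | Squarefree d ∧ |d| ≤ (X : ℤ) ∧ P d} ⊆
      {d : ℤ | Squarefree d ∧ |d| ≤ (X : ℤ) ∧ Q d} :=
    fun d hd ↦ ⟨hd.1, hd.2.1, hPQ d hd.1 hd.2.2⟩
  exact_mod_cast Nat.card_mono (finite_setOf_squarefree_abs_le X Q) hsub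

/-- **A lower bound and an enveloping density give the density**: if `P d → Q d` for squarefree `d`,
the `Q`-twists have density `δ`, and for every `ε > 0` the proportion of `P`-twists is eventually
`≥ δ − ε`, then the `P`-twists have density `δ`. [folklore] -/
theorem twistDensity_of_eventually_ge (hQ : twistDensity Q δ) (hPQ : ∀ d, Squarefree d → P d → Q d)
    (hlow : ∀ ε : ℝ, 0 < ε → ∀ᶠ X : ℕ in atTop,
      δ - ε ≤ (Nat.card {d : ℤ | Squarefree d ∧ |d| ≤ (X : ℤ) ∧ P d} : ℝ) /
        Nat.card {d : ℤ | Squarefree d ∧ |d| ≤ (X : ℤ)}) :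
    twistDensity P δ := by
  unfold twistDensity
  refine tendsto_order.2 ⟨fun a ha ↦ ?_, fun a ha ↦ ?_⟩
  · filter_upwards [hlow ((δ - a) / 2) (by linarith)] with X hX
    linarith
  · filter_upwards [hQ.eventually_ratio_le hPQ (ε := (a - δ) / 2) (by linarith)] with X hX
    linarith

variable (W : WeierstrassCurve ℚ) [W.IsElliptic]

/-- **The twists of odd `2^∞`-Selmer corank have density `1/2`** (complement of
`twistDensity_even_selmerCorankTwoInfty_of_exists_isNewformOf`; Modularity and Monsky's congruence).
[cite: arXiv250317619, §1 display (1.2)] [cite: MurtyMurty1997, Ch. 6 §1] -/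
theorem twistDensity_odd_selmerCorankTwoInfty_of_exists_isNewformOf (hmod : exists_isNewformOf)
    (hMon : monsky_selmerCorank_two_mod_two_eq) :
    twistDensity (fun d ↦ d ≠ 0 ∧ ¬ Even (selmerCorankTwoInfty (W.quadraticTwist d))) (1 / 2) := by
  have h := (twistDensity_even_selmerCorankTwoInfty_of_exists_isNewformOf W hmod hMon).compl
  rw [sub_half] at h
  refine (twistDensity_congr (fun d hd ↦ ?_) _).1 h
  have hd0 : d ≠ 0 := hd.ne_zero
  tauto

/-- **The upper half of Smith's Thm. 1.1 for corank `0`, from parity alone**: granted Modularity and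
Monsky's `2`-parity congruence, for every `ε > 0` the proportion of squarefree `|d| ≤ X` with
`r_{2^∞}(W^d) = 0` is eventually `≤ 1/2 + ε` (these twists have even corank, and the even-corank
twists have density `1/2`). The content of Thm. 1.1 is the matching lower bound.
[cite: arXiv250317619, Thm. 1.1 and §1 display (1.2)] -/
theorem eventually_ratio_selmerCorankTwoInfty_eq_zero_le (hmod : exists_isNewformOf)
    (hMon : monsky_selmerCorank_two_mod_two_eq) {ε : ℝ} (hε : 0 < ε) :
    ∀ᶠ X : ℕ in atTop, (Nat.card {d : ℤ | Squarefree d ∧ |d| ≤ (X : ℤ) ∧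
        (d ≠ 0 ∧ selmerCorankTwoInfty (W.quadraticTwist d) = 0)} : ℝ) /
      Nat.card {d : ℤ | Squarefree d ∧ |d| ≤ (X : ℤ)} ≤ 1 / 2 + ε :=
  (twistDensity_even_selmerCorankTwoInfty_of_exists_isNewformOf W hmod hMon).eventually_ratio_le
    (fun _ _ hd ↦ ⟨hd.1, by rw [hd.2]; exact Even.zero⟩) hε

/-- **The upper half of Smith's Thm. 1.1 for corank `1`, from parity alone**: as
`eventually_ratio_selmerCorankTwoInfty_eq_zero_le`, with the odd-corank twists (density `1/2`).
[cite: arXiv250317619, Thm. 1.1 and §1 display (1.2)] -/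
theorem eventually_ratio_selmerCorankTwoInfty_eq_one_le (hmod : exists_isNewformOf)
    (hMon : monsky_selmerCorank_two_mod_two_eq) {ε : ℝ} (hε : 0 < ε) :
    ∀ᶠ X : ℕ in atTop, (Nat.card {d : ℤ | Squarefree d ∧ |d| ≤ (X : ℤ) ∧
        (d ≠ 0 ∧ selmerCorankTwoInfty (W.quadraticTwist d) = 1)} : ℝ) /
      Nat.card {d : ℤ | Squarefree d ∧ |d| ≤ (X : ℤ)} ≤ 1 / 2 + ε :=
  (twistDensity_odd_selmerCorankTwoInfty_of_exists_isNewformOf W hmod hMon).eventually_ratio_le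
    (fun _ _ hd ↦ ⟨hd.1, by rw [hd.2]; exact Nat.not_even_one⟩) hε

/-- **Smith's Thm. 1.1 is equivalent to its two lower bounds** (granted Modularity and Monsky's
`2`-parity congruence): `smith_selmerCorank_density W` holds iff for every `ε > 0` the proportions of
squarefree `|d| ≤ X` with `r_{2^∞}(W^d) = 0`, resp. `= 1`, are eventually `≥ 1/2 − ε` — the upper
bounds being automatic from the equidistribution of the parity
(`eventually_ratio_selmerCorankTwoInfty_eq_zero_le/one_le`). [cite: arXiv250317619, Thm. 1.1 and §1 display (1.2)] -/
theorem smith_selmerCorank_density_iff_eventually_ge (hmod : exists_isNewformOf)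
    (hMon : monsky_selmerCorank_two_mod_two_eq) :
    smith_selmerCorank_density W ↔
      (∀ ε : ℝ, 0 < ε → ∀ᶠ X : ℕ in atTop,
        1 / 2 - ε ≤ (Nat.card {d : ℤ | Squarefree d ∧ |d| ≤ (X : ℤ) ∧
            (d ≠ 0 ∧ selmerCorankTwoInfty (W.quadraticTwist d) = 0)} : ℝ) /
          Nat.card {d : ℤ | Squarefree d ∧ |d| ≤ (X : ℤ)}) ∧
      (∀ ε : ℝ, 0 < ε → ∀ᶠ X : ℕ in atTop,
        1 / 2 - ε ≤ (Nat.card {d : ℤ | Squarefree d ∧ |d| ≤ (X : ℤ) ∧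
            (d ≠ 0 ∧ selmerCorankTwoInfty (W.quadraticTwist d) = 1)} : ℝ) /
          Nat.card {d : ℤ | Squarefree d ∧ |d| ≤ (X : ℤ)}) := by
  rw [smith_selmerCorank_density_iff]
  constructor
  · rintro ⟨h0, h1⟩
    refine ⟨fun ε hε ↦ ?_, fun ε hε ↦ ?_⟩
    · filter_upwards [(tendsto_order.1 h0).1 _ (by linarith : (1 : ℝ) / 2 - ε < 1 / 2)] with X hX
      exact hX.le
    · filter_upwards [(tendsto_order.1 h1).1 _ (by linarith : (1 : ℝ) / 2 - ε < 1 / 2)] with X hX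
      exact hX.le
  · rintro ⟨h0, h1⟩
    exact ⟨twistDensity_of_eventually_ge
        (twistDensity_even_selmerCorankTwoInfty_of_exists_isNewformOf W hmod hMon)
        (fun _ _ hd ↦ ⟨hd.1, by rw [hd.2]; exact Even.zero⟩) h0,
      twistDensity_of_eventually_ge (twistDensity_odd_selmerCorankTwoInfty_of_exists_isNewformOf W hmod hMon)
        (fun _ _ hd ↦ ⟨hd.1, by rw [hd.2]; exact Nat.not_even_one⟩) h1⟩

end OneSided

end Literature.NumberTheory.EllipticCurves

end
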